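import Mathlib.Analysis.SpecialFunctions.Elliptic.Weierstrass
import Mathlib.Analysis.Complex.CauchyIntegral
import Mathlib.Analysis.Complex.Liouville
import Mathlib.Analysis.Complex.OpenMapping
import Mathlib.Analysis.Analytic.Order
import Mathlib.Analysis.Calculus.IteratedDeriv.Lemmas
import Literature.NumberTheory.EllipticCurves.WeierstrassZeta
import Literature.NumberTheory.EllipticCurves.WeierstrassZetaLegendre
import Literature.NumberTheory.EllipticCurves.WeierstrassSigma
import Literature.NumberTheory.EllipticCurves.WeierstrassSigmaProofs
import Literature.NumberTheory.EllipticCurves.RealLatticePeriodProofs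
import Literature.NumberTheory.EllipticCurves.RealLatticePeriodHalfPeriodsProofs
import Literature.NumberTheory.Transcendental.BakerLogarithmsAnalytic
import Mathlib.Analysis.Calculus.MeanValue
import Mathlib.Algebra.MvPolynomial.Derivation
import Mathlib.Algebra.MvPolynomial.Eval
import HarnessLib

/-!
# Chudnovsky's theorem on periods — the analytic core (auxiliary function, Schwarz lemma)

Topic `Literature/NumberTheory/Transcendental` (trunk T-TRANSCEND). Node [AN] of the proof of
`Literature.NumberTheory.Transcendental.Chudnovsky1984_thm_7_3_1` (Chudnovsky 1984, Ch. 7, Theorem 3.1, p. 309: for every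
lattice two of `g₂, g₃, π/ω, η/ω` are algebraically independent), see
`Transcendental/ChudnovskyPeriods.lean` for the reduction layer and the plan.

Chudnovsky 1984, Ch. 7, §3 (pp. 309–310) considers, for a polynomial `P(x, y)` of bidegree
`≤ (L₁, L₂)`, the meromorphic auxiliary function `F(z) = P(ζ(z) - (η/ω) z, ℘(z))`, which is
`ω`-periodic, takes at the points `ω/2 + m ω'` values which are polynomials in `η/ω`, `g₂`,
`℘(ω/2)` and the Legendre constant `2πi/ω`, and becomes entire of order `2` after
multiplication by `σ(z)^{L₁ + 2L₂}`; Schwarz's lemma for this entire function on a large disc,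
division by `σ`, and Cauchy's inequalities give the fundamental upper bound for the derivatives
`F^{(k)}(ω/2 + m ω')` once `F` is known to vanish to high order at many such points
("we use Schwarz' lemma applied to the function `σ(z)^{3L} F(z)`", loc. cit. p. 306 and p. 310).

This file carries out exactly this analytic part, for the basis `(ω, ω') = (ω₁, ω₂)` of an
arbitrary `PeriodPair` and `L₁ = L₂ = D`:

* preliminaries on `σ` (from the discharged facts of `WeierstrassSigma.lean` and the growth bound
  `exists_norm_weierstrassSigma_le_exp` of `WeierstrassSigmaProofs.lean`): `σ' = ζσ`
  (`deriv_weierstrassSigma`), growth of `σ, σ', σ''` (`norm_weierstrassSigma_derivs_le_exp`, by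
  Cauchy's inequality) and the lower bound `‖σ(k + nω₂)‖ ≥ c e^{-Cn²}` on compact sets avoiding
  the lattice (`le_norm_weierstrassSigma_add_nat_mul_ω₂`);

* the numbers `κ = η₁/ω₁`, `c = η₂ - κ ω₂` (`= ∓2πi/ω₁ ≠ 0` by Legendre), `e₁ = ℘(ω₁/2)`, the
  function `g = ζ - κ·id` (`ω₁`-periodic, `g(z + ω₂) = g(z) + c`, `g(ω₁/2) = 0`) and the points
  `s_m = ω₁/2 + m ω₂` (`g(s_m) = m c`, `℘(s_m) = e₁`, `℘'(s_m) = 0`);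
* the auxiliary function `F_p(z) = ∑_{i,j ≤ D} p_{ij} g(z)^i ℘(z)^j` of a coefficient family
  `p : Fin (D+1) × Fin (D+1) → ℂ`, and the entire function
  `G_p = ∑ p_{ij} (σg)^i (σ²℘)^j σ^{3D-i-2j} = σ^{3D} F_p` (`σ g = σ' - κ z σ`,
  `σ² ℘ = σ'² - σ σ''` are entire), with the growth bound
  `‖G_p(z)‖ ≤ ‖p‖ exp(C (D+1) (1 + |z|²))`;
* `norm_G_le_of_zeros`: if `F_p^{(j)}(s_m) = 0` for `j < T`, `m < X`, then by `ω₁`-periodicity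
  `G_p` vanishes to order `≥ T` at the `X(2X+1)` points `s_m + n ω₁` (`|n| ≤ X`), and Schwarz's
  lemma (`Baker1975.Analytic.norm_le_of_analyticOrderAt`) gives
  `‖G_p(w)‖ ≤ ‖p‖ e^{C (D+1) ϱ²} e^{-T X²}` for `|w| ≤ ϱ`, `ϱ ≥ r₀ X`;
* `norm_iteratedDeriv_F_le_of_zeros`: the upper bound
  `|F_p^{(j)}(s_{m₀})| ≤ ‖p‖ · j! · e^{C((D+1) X² + j)} e^{-T X²}` (`m₀ < X`), by division by
  `σ^{3D}` on a small circle around `s_{m₀}` and Cauchy's inequality;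
* `norm_F_translate_le_of_zeros`: the bound `|F_p(z + m ω₂)| ≤ ‖p‖ e^{C (D+1)(X+M)²} e^{-T X²}`
  for `z` in a fixed small disc `B` around `ω₁/2` and `m ≤ M` (input of the zero estimate),
  together with the fact that `℘(B)` contains a disc around `e₁` (open mapping theorem,
  `not_eventually_const_weierstrassP`).

All constants are existentially quantified and depend only on the lattice.

## Part II — differential algebra (formerly planned as a separate file)

Chudnovsky 1984, Ch. 7, §2, p. 306: "`(d/dz) P₁(℘(z), ℘'(z), ζ(z))` for
`P₁(x₁, x₂, x₃) ∈ ℚ[x₁, x₂, x₃]` … are of the form `P₂(℘(z), ℘'(z), ζ(z))`", i.e. the ring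
`ℚ(g₂, g₃, η/ω)[ζ(z) - (η/ω)z, ℘(z), ℘'(z)]` is closed under `d/dz`:
`g' = -℘ - η/ω`, `℘' = ℘'`, `℘'' = 6℘² - g₂/2`. Consequently the derivatives `F^{(k)}(z)` of the
auxiliary function `F(z) = P(g(z), ℘(z))` are `(D^k P)(g(z), ℘(z), ℘'(z))` for the derivation
`D = (-Y - κ) ∂_X + W ∂_Y + (6Y² - g₂/2) ∂_W`, and their values at the points
`s_m = ω₁/2 + mω₂` (where `g = mc`, `℘ = e₁`, `℘' = 0`) are *integer* polynomials in
`κ = η₁/ω₁`, `g₂/2`, `c`, `e₁` and `m` — the shape needed for Siegel's lemma and for the final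
norm computation in Gelfond's method.

### Contents of Part II

* `chudD a b` — the derivation `D_{a,b}` of `R[X, Y, W]` (`= MvPolynomial (Fin 3) R`) with
  `D X = -Y - a`, `D Y = W`, `D W = 6Y² - b`, over any commutative ring `R`
  (`MvPolynomial.mkDerivation`).
* the relation `℘'' = 6℘² - g₂/2` off the lattice is `PeriodPair.deriv_derivWeierstrassP`
  (`RealLatticePeriodHalfPeriodsProofs.lean`).
* `hasDerivAt_eval_v`, `iteratedDeriv_eval_v` — the chain rule
  `(d/dz)^k P(g, ℘, ℘')(z) = (D^k P)(g, ℘, ℘')(z)` for `z ∉ Λ` (`D = D_{κ, g₂/2}` over `ℂ`).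
* `toPoly p`, `F_eq_eval_toPoly` — the auxiliary function of `ChudnovskyAnalytic.lean` is
  `F_p(z) = (toPoly p)(g(z), ℘(z), ℘'(z))`.
* The formal side: `R₇ = ℤ[X₀, X₁, X₂; a₀, …, a₃]` with the derivation `D₀` (`D a_l = 0`),
  `R₄ = ℤ[a₀, …, a₃]` (`a = (κ, g₂/2, c, e₁)`), the integer polynomials
  `V j m i k = (D₀^j (X₀ⁱX₁ᵏ))(m a₂, a₃, 0; a) ∈ R₄`, the specialisations `φx : R₄ → ℂ`,
  `ψx : R₇ → ℂ[X]` (`ψx ∘ D₀ = D ∘ ψx`) and the **value formula**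
  `iteratedDeriv_F_s : F_p^{(j)}(s_m) = ∑ p (i,k) · φx (V j m i k)`.
-/

noncomputable section

open Complex Metric Filter Topology Finset
open scoped PeriodPair

namespace Literature.NumberTheory.Transcendental.Chudnovsky

variable (L : PeriodPair)

/-! ### Preliminaries: bounds for `σ` used with Schwarz's lemma -/

/-- `σ' = ζ σ` off the lattice (from `logDeriv σ = ζ`). [cite: WhittakerWatson1927, §20.42] -/
theorem deriv_weierstrassSigma {x : ℂ} (hx : x ∉ L.lattice) :
    deriv L.weierstrassSigma x = L.weierstrassZeta x * L.weierstrassSigma x := by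
  have h := L.logDeriv_weierstrassSigma_holds x hx
  rw [logDeriv_apply, div_eq_iff (L.weierstrassSigma_ne_zero hx)] at h
  exact h

/-- Cauchy's estimate propagates order-`2` growth to the derivative: if
`‖f z‖ ≤ e^{C(1+|z|²)}` for an entire `f`, then `‖f' z‖ ≤ e^{3C(1+|z|²)}` (Cauchy's inequality
on the circle of radius `1`). [folklore] -/
theorem norm_deriv_le_exp_of_le_exp {f : ℂ → ℂ} (hf : Differentiable ℂ f) {C : ℝ} (hC : 0 ≤ C)
    (h : ∀ z, ‖f z‖ ≤ Real.exp (C * (1 + ‖z‖ ^ 2))) (z : ℂ) :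
    ‖deriv f z‖ ≤ Real.exp (3 * C * (1 + ‖z‖ ^ 2)) := by
  have key := Complex.norm_deriv_le_of_forall_mem_sphere_norm_le (f := f) (c := z) (R := 1)
    (C := Real.exp (3 * C * (1 + ‖z‖ ^ 2))) one_pos hf.diffContOnCl (fun w hw => ?_)
  · simpa using key
  · refine (h w).trans (Real.exp_le_exp.mpr ?_)
    have hw : ‖w‖ ≤ ‖z‖ + 1 := by
      have : dist w z = 1 := hw
      calc ‖w‖ = ‖(w - z) + z‖ := by ring_nf
        _ ≤ ‖w - z‖ + ‖z‖ := norm_add_le _ _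
        _ = 1 + ‖z‖ := by rw [← dist_eq_norm, this]
        _ = ‖z‖ + 1 := add_comm _ _
    have hw2 : ‖w‖ ^ 2 ≤ (‖z‖ + 1) ^ 2 := pow_le_pow_left₀ (norm_nonneg _) hw 2
    nlinarith [sq_nonneg (‖z‖ - 1), norm_nonneg z]

/-- **Growth of `σ, σ', σ''`** with one constant: `‖σ‖, ‖σ'‖, ‖σ''‖ ≤ e^{C(1 + |z|²)}`
(order two; Chudnovsky 1984, Ch. 7, p. 306: "`|σ(z)| ≤ exp(c R²)`").
[cite: Chudnovsky1984, Ch. 7 §2 p. 306] -/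
theorem norm_weierstrassSigma_derivs_le_exp :
    ∃ C : ℝ, 0 ≤ C ∧ ∀ z : ℂ,
      ‖L.weierstrassSigma z‖ ≤ Real.exp (C * (1 + ‖z‖ ^ 2)) ∧
      ‖deriv L.weierstrassSigma z‖ ≤ Real.exp (C * (1 + ‖z‖ ^ 2)) ∧
      ‖deriv (deriv L.weierstrassSigma) z‖ ≤ Real.exp (C * (1 + ‖z‖ ^ 2)) := by
  obtain ⟨C, hC0, hC⟩ := L.exists_norm_weierstrassSigma_le_exp
  have hσ := L.differentiable_weierstrassSigma_holds
  have h1 := norm_deriv_le_exp_of_le_exp hσ hC0.le hC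
  have h2 := norm_deriv_le_exp_of_le_exp hσ.deriv (by positivity) h1
  refine ⟨9 * C, by positivity, fun z => ⟨?_, ?_, ?_⟩⟩
  · exact (hC z).trans (Real.exp_le_exp.mpr (by nlinarith [sq_nonneg ‖z‖]))
  · exact (h1 z).trans (Real.exp_le_exp.mpr (by nlinarith [sq_nonneg ‖z‖]))
  · exact (h2 z).trans (Real.exp_le_exp.mpr (by nlinarith [sq_nonneg ‖z‖]))

/-- The exponent of the iterated quasi-periodicity formula is `O(n²)` uniformly for `z` in a
bounded set: `-(‖η‖(ρ + ‖ω‖)) n² ≤ Re(η(nz + n²ω/2))` when `‖z‖ ≤ ρ`, `ρ ≥ 0`. [folklore] -/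
lemma neg_mul_sq_le_re_exponent (η ω z : ℂ) {ρ : ℝ} (hρ : 0 ≤ ρ) (hz : ‖z‖ ≤ ρ) (n : ℕ) :
    -(‖η‖ * (ρ + ‖ω‖) * (n : ℝ) ^ 2) ≤ (η * (n * z + n ^ 2 * ω / 2)).re := by
  have hre : |(η * (n * z + n ^ 2 * ω / 2)).re| ≤ ‖η‖ * ((n : ℝ) * ‖z‖ + (n : ℝ) ^ 2 * ‖ω‖) := by
    refine (Complex.abs_re_le_norm _).trans ?_
    rw [norm_mul]
    refine mul_le_mul_of_nonneg_left ((norm_add_le _ _).trans ?_) (norm_nonneg _)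
    rw [norm_mul, Complex.norm_natCast, norm_div, norm_mul, norm_pow, Complex.norm_natCast,
      Complex.norm_two]
    have : 0 ≤ (n : ℝ) ^ 2 * ‖ω‖ := by positivity
    linarith
  have hn0 : (0 : ℝ) ≤ n := Nat.cast_nonneg n
  have hnn : (n : ℝ) ≤ (n : ℝ) ^ 2 := by
    rcases Nat.eq_zero_or_pos n with h0 | hpos
    · simp [h0]
    · have : (1 : ℝ) ≤ n := by exact_mod_cast hpos
      nlinarith
  have h1 : (n : ℝ) * ‖z‖ + (n : ℝ) ^ 2 * ‖ω‖ ≤ (ρ + ‖ω‖) * (n : ℝ) ^ 2 := by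
    have : (n : ℝ) * ‖z‖ ≤ (n : ℝ) ^ 2 * ρ :=
      (mul_le_mul_of_nonneg_left hz hn0).trans (mul_le_mul_of_nonneg_right hnn hρ)
    nlinarith
  have h2 := mul_le_mul_of_nonneg_left h1 (norm_nonneg η)
  linarith [neg_abs_le ((η * (n * z + n ^ 2 * ω / 2)).re)]

/-- **Lower bound along `ω₂`-translates**: for a compact set `K` avoiding the lattice there are
`c > 0` and `C ≥ 0` with `‖σ(k + nω₂)‖ ≥ c·exp(-C n²)` for all `k ∈ K`, `n ∈ ℕ` (iterated
quasi-periodicity `norm_weierstrassSigma_add_nat_mul` and `min_K ‖σ‖ > 0`). This is the input for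
dividing by `σ^{3L}` in Chudnovsky 1984, Ch. 7, §3, p. 310. [cite: Chudnovsky1984, Ch. 7 Thm 3.1 p. 310] -/
theorem le_norm_weierstrassSigma_add_nat_mul_ω₂ {K : Set ℂ} (hK : IsCompact K)
    (hKΛ : ∀ k ∈ K, k ∉ L.lattice) :
    ∃ c : ℝ, 0 < c ∧ ∃ C : ℝ, 0 ≤ C ∧ ∀ k ∈ K, ∀ n : ℕ,
      c * Real.exp (-(C * (n : ℝ) ^ 2)) ≤ ‖L.weierstrassSigma (k + n * L.ω₂)‖ := by
  rcases K.eq_empty_or_nonempty with rfl | hne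
  · exact ⟨1, one_pos, 0, le_rfl, fun k hk => (Set.notMem_empty k hk).elim⟩
  have hcont : ContinuousOn (fun z => ‖L.weierstrassSigma z‖) K :=
    L.differentiable_weierstrassSigma_holds.continuous.norm.continuousOn
  obtain ⟨k₀, hk₀, hmin⟩ := hK.exists_isMinOn hne hcont
  obtain ⟨ρ, hρ⟩ := hK.isBounded.exists_norm_le
  have hc0 : 0 < ‖L.weierstrassSigma k₀‖ := norm_pos_iff.mpr (L.weierstrassSigma_ne_zero (hKΛ k₀ hk₀))
  refine ⟨‖L.weierstrassSigma k₀‖, hc0, ‖L.η₂‖ * (max ρ 0 + ‖L.ω₂‖), by positivity,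
    fun k hk n => ?_⟩
  rw [L.norm_weierstrassSigma_add_nat_mul L.weierstrassSigma_add_ω₂_holds n k]
  have hkρ : ‖k‖ ≤ max ρ 0 := (hρ k hk).trans (le_max_left _ _)
  have hσk : ‖L.weierstrassSigma k₀‖ ≤ ‖L.weierstrassSigma k‖ := isMinOn_iff.mp hmin k hk
  have hE := neg_mul_sq_le_re_exponent L.η₂ L.ω₂ k (le_max_right _ _) hkρ n
  rw [mul_comm]
  exact mul_le_mul (Real.exp_le_exp.mpr hE) hσk (by positivity) (by positivity)

/-! ### The numbers `κ, c, e₁`, the function `g` and the points `s_m` -/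

/-- `κ = η₁/ω₁` (Chudnovsky's `η/ω`). [cite: Chudnovsky1984, Ch. 7 Thm 3.1 p. 309] -/
def κ : ℂ := L.η₁ / L.ω₁

/-- The constant `c = η₂ - κ ω₂` by which `g = ζ - κ z` shifts under `z ↦ z + ω₂`; by the
Legendre relation `c = ∓ 2πi/ω₁ ≠ 0`. [cite: Chudnovsky1984, Ch. 7 Thm 3.1 p. 309] -/
def c : ℂ := L.η₂ - κ L * L.ω₂

/-- The `ω₁`-periodic function `g(z) = ζ(z) - (η₁/ω₁) z` (Chudnovsky's `ζ(z) - (η/ω) z`).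
[cite: Chudnovsky1984, Ch. 7 Thm 3.1 p. 309] -/
def g (z : ℂ) : ℂ := L.weierstrassZeta z - κ L * z

/-- `e₁ = ℘(ω₁/2)`, a root of `4x³ - g₂x - g₃`. [folklore] -/
def e₁ : ℂ := ℘[L] (L.ω₁ / 2)

/-- The points `s_m = ω₁/2 + m ω₂` at which the auxiliary function is made to vanish.
[cite: Chudnovsky1984, Ch. 7 Thm 3.1 p. 309] -/
def s (m : ℕ) : ℂ := L.ω₁ / 2 + m * L.ω₂

/-- `ω₁ ≠ 0`. [folklore] -/
lemma ω₁_ne_zero : L.ω₁ ≠ 0 := by simpa using L.indep.ne_zero 0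

/-- `ω₂ ≠ 0`. [folklore] -/
lemma ω₂_ne_zero : L.ω₂ ≠ 0 := by simpa using L.indep.ne_zero 1

/-- `κ ω₁ = η₁`. [folklore] -/
@[simp] lemma κ_mul_ω₁ : κ L * L.ω₁ = L.η₁ := by
  unfold κ; field_simp [ω₁_ne_zero L]

/-- `g(z + ω₁) = g(z)` for all `z`. [folklore] -/
theorem g_add_ω₁ (z : ℂ) : g L (z + L.ω₁) = g L z := by
  unfold g
  rw [L.weierstrassZeta_add_ω₁_eq, mul_add, κ_mul_ω₁]
  ring

/-- `g(z + ω₂) = g(z) + c` for all `z`. [folklore] -/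
theorem g_add_ω₂ (z : ℂ) : g L (z + L.ω₂) = g L z + c L := by
  unfold g c
  rw [L.weierstrassZeta_add_ω₂_eq]
  ring

/-- `g` is `ω₁`-periodic. [folklore] -/
theorem g_periodic : Function.Periodic (g L) L.ω₁ := g_add_ω₁ L

/-- `g(z + nω₁) = g(z)`, `n ∈ ℤ`. [folklore] -/
theorem g_add_int_mul_ω₁ (z : ℂ) (n : ℤ) : g L (z + n * L.ω₁) = g L z :=
  (g_periodic L).int_mul n z

/-- `g(z + mω₂) = g(z) + m c`. [folklore] -/
theorem g_add_nat_mul_ω₂ (z : ℂ) (m : ℕ) : g L (z + m * L.ω₂) = g L z + m * c L := by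
  induction m with
  | zero => simp
  | succ m ih =>
    have : z + ((m + 1 : ℕ) : ℂ) * L.ω₂ = (z + m * L.ω₂) + L.ω₂ := by push_cast; ring
    rw [this, g_add_ω₂, ih]
    push_cast
    ring

/-- `g(ω₁/2) = 0` (as `η₁ = 2ζ(ω₁/2)`). [folklore] -/
theorem g_ω₁_div_two : g L (L.ω₁ / 2) = 0 := by
  unfold g κ PeriodPair.η₁
  field_simp [ω₁_ne_zero L]
  ring

/-- `g(s_m) = m c`. [folklore] -/
theorem g_s (m : ℕ) : g L (s L m) = m * c L := by
  unfold s
  rw [g_add_nat_mul_ω₂, g_ω₁_div_two, zero_add]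

/-- `m ω₂ ∈ Λ`. [folklore] -/
lemma nat_mul_ω₂_mem (m : ℕ) : (m : ℂ) * L.ω₂ ∈ L.lattice := by
  simpa using L.lattice.smul_mem (m : ℤ) L.ω₂_mem_lattice

/-- `n ω₁ ∈ Λ`. [folklore] -/
lemma int_mul_ω₁_mem (n : ℤ) : (n : ℂ) * L.ω₁ ∈ L.lattice := by
  simpa using L.lattice.smul_mem n L.ω₁_mem_lattice

/-- Translating a non-lattice point by a lattice vector gives a non-lattice point. [folklore] -/
lemma add_notMem {x ω : ℂ} (hx : x ∉ L.lattice) (hω : ω ∈ L.lattice) : x + ω ∉ L.lattice :=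
  fun h => hx (by simpa using sub_mem h hω)

/-- `s_m ∉ Λ`. [folklore] -/
theorem s_notMem (m : ℕ) : s L m ∉ L.lattice :=
  add_notMem L L.ω₁_div_two_notMem_lattice (nat_mul_ω₂_mem L m)

/-- `s_m + nω₁ ∉ Λ`. [folklore] -/
theorem s_add_int_mul_notMem (m : ℕ) (n : ℤ) : s L m + n * L.ω₁ ∉ L.lattice :=
  add_notMem L (s_notMem L m) (int_mul_ω₁_mem L n)

/-- `℘(s_m) = e₁`. [folklore] -/
theorem weierstrassP_s (m : ℕ) : ℘[L] (s L m) = e₁ L := by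
  unfold s e₁
  simpa using L.weierstrassP_add_coe (L.ω₁ / 2) ⟨m * L.ω₂, nat_mul_ω₂_mem L m⟩

/-- `℘'(ω₁/2) = 0` (`℘'` is odd and `ω₁`-periodic). [folklore] -/
theorem derivWeierstrassP_ω₁_div_two : ℘'[L] (L.ω₁ / 2) = 0 := by
  have h1 : ℘'[L] (-(L.ω₁ / 2) + L.ω₁) = ℘'[L] (-(L.ω₁ / 2)) :=
    L.derivWeierstrassP_add_coe (-(L.ω₁ / 2)) ⟨L.ω₁, L.ω₁_mem_lattice⟩
  rw [show -(L.ω₁ / 2) + L.ω₁ = L.ω₁ / 2 by ring, L.derivWeierstrassP_neg] at h1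
  linear_combination h1 / 2

/-- `℘'(s_m) = 0`. [folklore] -/
theorem derivWeierstrassP_s (m : ℕ) : ℘'[L] (s L m) = 0 := by
  unfold s
  have h := L.derivWeierstrassP_add_coe (L.ω₁ / 2) ⟨m * L.ω₂, nat_mul_ω₂_mem L m⟩
  simp only at h
  rw [h, derivWeierstrassP_ω₁_div_two]

/-- `c ω₁ = η₂ ω₁ - η₁ ω₂ (= ∓ 2πi)`. [folklore] -/
theorem c_mul_ω₁ : c L * L.ω₁ = L.η₂ * L.ω₁ - L.η₁ * L.ω₂ := by
  unfold c κ
  field_simp [ω₁_ne_zero L]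

/-- `c ≠ 0` (Legendre's relation). [folklore] -/
theorem c_ne_zero : c L ≠ 0 := by
  intro h
  have h1 := c_mul_ω₁ L
  rw [h, zero_mul] at h1
  have hpi : (2 * Real.pi * I : ℂ) ≠ 0 := by simp [Real.pi_ne_zero]
  rcases L.legendre_relation_up_to_sign with h2 | h2
  · exact hpi (by linear_combination h1 - h2)
  · exact hpi (by linear_combination -h1 - h2)

/-- `c² = -4π²/ω₁²`: `c` is algebraic over `ℚ(π/ω₁)`. [folklore] -/
theorem c_sq : c L ^ 2 = -4 * ((Real.pi : ℂ) / L.ω₁) ^ 2 := by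
  have hω := ω₁_ne_zero L
  have h1 : c L = (L.η₂ * L.ω₁ - L.η₁ * L.ω₂) / L.ω₁ := by
    rw [← c_mul_ω₁]; field_simp
  have hsq : (L.η₂ * L.ω₁ - L.η₁ * L.ω₂) ^ 2 = (2 * Real.pi * I) ^ 2 := by
    rcases L.legendre_relation_up_to_sign with h2 | h2
    · rw [← h2]; ring
    · rw [← h2]
  rw [h1, div_pow, hsq]
  field_simp
  ring_nf
  rw [Complex.I_sq]
  ring

/-- `4e₁³ - g₂e₁ - g₃ = 0` (`℘'(ω₁/2) = 0` in `℘'² = 4℘³ - g₂℘ - g₃`): `e₁` is algebraic over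
`ℚ(g₂, g₃)`. [folklore] -/
theorem e₁_cubic : 4 * e₁ L ^ 3 - L.g₂ * e₁ L - L.g₃ = 0 := by
  have h := L.derivWeierstrassP_sq (L.ω₁ / 2) L.ω₁_div_two_notMem_lattice
  rw [derivWeierstrassP_ω₁_div_two] at h
  unfold e₁
  linear_combination -h

/-! ### Analyticity of `g` -/

/-- `g` is holomorphic off the lattice. [folklore] -/
theorem differentiableOn_g : DifferentiableOn ℂ (g L) L.latticeᶜ := by
  unfold g
  exact L.differentiableOn_weierstrassZeta_holds.sub (by fun_prop)

/-- `g` is analytic at every non-lattice point. [folklore] -/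
theorem analyticAt_g {z : ℂ} (hz : z ∉ L.lattice) : AnalyticAt ℂ (g L) z :=
  (differentiableOn_g L).analyticAt (L.isClosed_lattice.isOpen_compl.mem_nhds hz)

/-! ### The auxiliary function `F_p` -/

/-- The auxiliary function `F_p(z) = ∑_{i,j ≤ D} p (i,j) g(z)^i ℘(z)^j` of a coefficient family
`p` of bidegree `≤ (D, D)` (Chudnovsky's `F(z) = P(ζ(z) - (η/ω)z, ℘(z))`).
[cite: Chudnovsky1984, Ch. 7 Thm 3.1 p. 309] -/
def F (D : ℕ) (p : Fin (D + 1) × Fin (D + 1) → ℂ) (z : ℂ) : ℂ :=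
  ∑ l, p l * (g L z ^ (l.1 : ℕ) * ℘[L] z ^ (l.2 : ℕ))

variable {D : ℕ}

/-- `F_p` is `ω₁`-periodic. [folklore] -/
theorem F_add_ω₁ (p : Fin (D + 1) × Fin (D + 1) → ℂ) (z : ℂ) :
    F L D p (z + L.ω₁) = F L D p z := by
  unfold F
  simp_rw [g_add_ω₁, L.weierstrassP_add_coe z ⟨L.ω₁, L.ω₁_mem_lattice⟩]

/-- `F_p(z + nω₁) = F_p(z)`, `n ∈ ℤ`. [folklore] -/
theorem F_add_int_mul_ω₁ (p : Fin (D + 1) × Fin (D + 1) → ℂ) (z : ℂ) (n : ℤ) :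
    F L D p (z + n * L.ω₁) = F L D p z :=
  (show Function.Periodic (F L D p) L.ω₁ from F_add_ω₁ L p).int_mul n z

/-- `F_p(z + mω₂) = ∑ p (i,j) (g(z) + m c)^i ℘(z)^j`. [folklore] -/
theorem F_add_nat_mul_ω₂ (p : Fin (D + 1) × Fin (D + 1) → ℂ) (z : ℂ) (m : ℕ) :
    F L D p (z + m * L.ω₂) = ∑ l, p l * ((g L z + m * c L) ^ (l.1 : ℕ) * ℘[L] z ^ (l.2 : ℕ)) := by
  unfold F
  simp_rw [g_add_nat_mul_ω₂, L.weierstrassP_add_coe z ⟨_, nat_mul_ω₂_mem L m⟩]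

/-- `F_p(s_m) = ∑ p (i,j) (m c)^i e₁^j`. [folklore] -/
theorem F_s (p : Fin (D + 1) × Fin (D + 1) → ℂ) (m : ℕ) :
    F L D p (s L m) = ∑ l, p l * ((m * c L) ^ (l.1 : ℕ) * e₁ L ^ (l.2 : ℕ)) := by
  unfold F
  simp_rw [g_s, weierstrassP_s]

/-- `F_p` is analytic at every non-lattice point. [folklore] -/
theorem analyticAt_F (p : Fin (D + 1) × Fin (D + 1) → ℂ) {z : ℂ} (hz : z ∉ L.lattice) :
    AnalyticAt ℂ (F L D p) z := by
  have h0 := analyticAt_g L hz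
  have h1 := L.analyticOnNhd_weierstrassP z hz
  unfold F
  refine Finset.analyticAt_fun_sum _ fun l _ => ?_
  exact analyticAt_const.mul ((h0.pow _).mul (h1.pow _))

/-- `F_p` is holomorphic off the lattice. [folklore] -/
theorem differentiableOn_F (p : Fin (D + 1) × Fin (D + 1) → ℂ) :
    DifferentiableOn ℂ (F L D p) L.latticeᶜ :=
  fun _ hz => (analyticAt_F L p hz).differentiableAt.differentiableWithinAt

/-- The terms of `F_p` are bounded by `‖p‖`: `‖p l‖ ≤ ‖p‖` (sup norm). [folklore] -/
lemma norm_apply_le (p : Fin (D + 1) × Fin (D + 1) → ℂ) (l : Fin (D + 1) × Fin (D + 1)) :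
    ‖p l‖ ≤ ‖p‖ := norm_le_pi_norm p l

/-! ### The entire function `G_p = σ^{3D} F_p` -/

/-- `σ g = σ' - κ z σ`, an entire function (equal to `σ(z) g(z)` off the lattice). [folklore] -/
def Sg (z : ℂ) : ℂ := deriv L.weierstrassSigma z - κ L * z * L.weierstrassSigma z

/-- `σ² ℘ = σ'² - σ σ''`, an entire function (equal to `σ(z)² ℘(z)` off the lattice). [folklore] -/
def Sp (z : ℂ) : ℂ :=
  deriv L.weierstrassSigma z ^ 2 - L.weierstrassSigma z * deriv (deriv L.weierstrassSigma) z

/-- The entire function `G_p = ∑ p (i,j) (σg)^i (σ²℘)^j σ^{3D - i - 2j}`, equal to `σ^{3D} F_p`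
off the lattice (Chudnovsky: "`σ(z)^{3L} F(z)` is an entire function").
[cite: Chudnovsky1984, Ch. 7 Thm 3.1 p. 309] -/
def G (D : ℕ) (p : Fin (D + 1) × Fin (D + 1) → ℂ) (z : ℂ) : ℂ :=
  ∑ l, p l * (Sg L z ^ (l.1 : ℕ) * Sp L z ^ (l.2 : ℕ) *
    L.weierstrassSigma z ^ (3 * D - l.1 - 2 * l.2))

/-- `σ(z) g(z) = Sg(z)` off the lattice (`σ' = ζ σ`). [folklore] -/
theorem sigma_mul_g {z : ℂ} (hz : z ∉ L.lattice) :
    L.weierstrassSigma z * g L z = Sg L z := by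
  unfold g Sg
  rw [deriv_weierstrassSigma L hz]
  ring

/-- `σ(z)² ℘(z) = Sp(z)` off the lattice (differentiate `ζ = σ'/σ` and use `ζ' = -℘`). [folklore] -/
theorem sigma_sq_mul_weierstrassP {z : ℂ} (hz : z ∉ L.lattice) :
    L.weierstrassSigma z ^ 2 * ℘[L] z = Sp L z := by
  have hσd := L.differentiable_weierstrassSigma_holds
  have hσ0 := L.weierstrassSigma_ne_zero hz
  -- `ζ = σ'/σ` on a neighbourhood of `z`
  have hev : L.weierstrassZeta =ᶠ[𝓝 z]
      fun w => deriv L.weierstrassSigma w / L.weierstrassSigma w := by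
    filter_upwards [L.isClosed_lattice.isOpen_compl.mem_nhds hz] with w hw
    exact ((L.logDeriv_weierstrassSigma_iff).mp L.logDeriv_weierstrassSigma_holds w hw).symm
  have h1 : deriv L.weierstrassZeta z = -℘[L] z := L.deriv_weierstrassZeta_holds z hz
  have h2 : deriv (fun w => deriv L.weierstrassSigma w / L.weierstrassSigma w) z =
      (deriv (deriv L.weierstrassSigma) z * L.weierstrassSigma z -
        deriv L.weierstrassSigma z * deriv L.weierstrassSigma z) / L.weierstrassSigma z ^ 2 :=
    deriv_div (Differentiable.deriv hσd z) (hσd z) hσ0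
  rw [hev.deriv_eq, h2] at h1
  unfold Sp
  field_simp at h1
  linear_combination h1

/-- `G_p = σ^{3D} F_p` off the lattice. [folklore] -/
theorem G_eq {z : ℂ} (hz : z ∉ L.lattice) (p : Fin (D + 1) × Fin (D + 1) → ℂ) :
    G L D p z = L.weierstrassSigma z ^ (3 * D) * F L D p z := by
  unfold G F
  rw [Finset.mul_sum]
  refine Finset.sum_congr rfl fun l _ => ?_
  rw [← sigma_mul_g L hz, ← sigma_sq_mul_weierstrassP L hz]
  have h1 : (l.1 : ℕ) ≤ D := Nat.lt_succ_iff.mp l.1.isLt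
  have h2 : (l.2 : ℕ) ≤ D := Nat.lt_succ_iff.mp l.2.isLt
  have hD : 3 * D = (3 * D - l.1 - 2 * l.2) + l.1 + 2 * l.2 := by omega
  conv_rhs => rw [hD]
  ring

/-- `G_p` and `σ^{3D} F_p` agree on a neighbourhood of every non-lattice point. [folklore] -/
theorem G_eventuallyEq {z : ℂ} (hz : z ∉ L.lattice) (p : Fin (D + 1) × Fin (D + 1) → ℂ) :
    G L D p =ᶠ[𝓝 z] (fun w => L.weierstrassSigma w ^ (3 * D)) * F L D p := by
  filter_upwards [L.isClosed_lattice.isOpen_compl.mem_nhds hz] with w hw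
  exact G_eq L hw p

/-- `Sg` is entire. [folklore] -/
theorem differentiable_Sg : Differentiable ℂ (Sg L) := by
  have hσ : Differentiable ℂ L.weierstrassSigma := L.differentiable_weierstrassSigma_holds
  have hσ' := hσ.deriv
  unfold Sg
  fun_prop

/-- `Sp` is entire. [folklore] -/
theorem differentiable_Sp : Differentiable ℂ (Sp L) := by
  have hσ : Differentiable ℂ L.weierstrassSigma := L.differentiable_weierstrassSigma_holds
  have hσ' := hσ.deriv
  have hσ'' := hσ'.deriv
  unfold Sp
  fun_prop

/-- `G_p` is entire. [folklore] -/
theorem differentiable_G (p : Fin (D + 1) × Fin (D + 1) → ℂ) : Differentiable ℂ (G L D p) := by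
  have hσ : Differentiable ℂ L.weierstrassSigma := L.differentiable_weierstrassSigma_holds
  have h1 := differentiable_Sg L
  have h2 := differentiable_Sp L
  unfold G
  fun_prop

/-! ### Growth of `G_p` -/

/-- `1 + t ≤ exp(1 + t²)` for `t ≥ 0`. [folklore] -/
lemma one_add_le_exp_one_add_sq (t : ℝ) : 1 + t ≤ Real.exp (1 + t ^ 2) := by
  have h1 : 1 + t ≤ 1 + (1 + t ^ 2) := by nlinarith [sq_nonneg (t - 1)]
  exact h1.trans (by linarith [Real.add_one_le_exp (1 + t ^ 2)])

/-- A uniform order-`2` bound for the three building blocks `Sg`, `Sp`, `σ` of `G_p`. [folklore] -/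
theorem exists_bound_Sg_Sp_sigma :
    ∃ C : ℝ, 0 ≤ C ∧ ∀ z : ℂ,
      ‖Sg L z‖ ≤ Real.exp (C * (1 + ‖z‖ ^ 2)) ∧ ‖Sp L z‖ ≤ Real.exp (C * (1 + ‖z‖ ^ 2)) ∧
        ‖L.weierstrassSigma z‖ ≤ Real.exp (C * (1 + ‖z‖ ^ 2)) := by
  obtain ⟨C₀, hC₀, h⟩ := norm_weierstrassSigma_derivs_le_exp L
  refine ⟨2 * C₀ + 1 + ‖κ L‖, by positivity, fun z => ?_⟩
  obtain ⟨hσ, hσ', hσ''⟩ := h z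
  set t : ℝ := 1 + ‖z‖ ^ 2 with ht
  have ht1 : 1 ≤ t := by rw [ht]; nlinarith [norm_nonneg z]
  have hE : 1 ≤ Real.exp (C₀ * t) := Real.one_le_exp (by positivity)
  refine ⟨?_, ?_, ?_⟩
  · -- `‖σ' - κ z σ‖ ≤ E (1 + ‖κ‖ ‖z‖) ≤ exp((2C₀ + 1 + ‖κ‖) t)`
    have hz1 : ‖z‖ ≤ Real.exp t := by
      have := one_add_le_exp_one_add_sq ‖z‖
      rw [ht]; linarith
    have hκ : 1 + ‖κ L‖ ≤ Real.exp (‖κ L‖ * t) := by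
      calc 1 + ‖κ L‖ ≤ ‖κ L‖ * t + 1 := by nlinarith [norm_nonneg (κ L)]
        _ ≤ Real.exp (‖κ L‖ * t) := Real.add_one_le_exp _
    calc ‖Sg L z‖ ≤ ‖deriv L.weierstrassSigma z‖ + ‖κ L * z * L.weierstrassSigma z‖ :=
          norm_sub_le _ _
      _ = ‖deriv L.weierstrassSigma z‖ + ‖κ L‖ * ‖z‖ * ‖L.weierstrassSigma z‖ := by
          rw [norm_mul, norm_mul]
      _ ≤ Real.exp (C₀ * t) + ‖κ L‖ * Real.exp t * Real.exp (C₀ * t) := by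
          gcongr
      _ = Real.exp (C₀ * t) * (1 + ‖κ L‖ * Real.exp t) := by ring
      _ ≤ Real.exp (C₀ * t) * ((1 + ‖κ L‖) * Real.exp t) := by
          refine mul_le_mul_of_nonneg_left ?_ (by positivity)
          nlinarith [Real.one_le_exp (show 0 ≤ t by linarith), norm_nonneg (κ L)]
      _ ≤ Real.exp (C₀ * t) * (Real.exp (‖κ L‖ * t) * Real.exp t) := by gcongr
      _ = Real.exp ((C₀ + ‖κ L‖ + 1) * t) := by
          rw [← Real.exp_add, ← Real.exp_add]; ring_nf
      _ ≤ Real.exp ((2 * C₀ + 1 + ‖κ L‖) * t) :=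
          Real.exp_le_exp.mpr (by nlinarith [norm_nonneg (κ L)])
  · calc ‖Sp L z‖ ≤ ‖deriv L.weierstrassSigma z ^ 2‖ +
          ‖L.weierstrassSigma z * deriv (deriv L.weierstrassSigma) z‖ := norm_sub_le _ _
      _ = ‖deriv L.weierstrassSigma z‖ ^ 2 +
          ‖L.weierstrassSigma z‖ * ‖deriv (deriv L.weierstrassSigma) z‖ := by
          rw [norm_pow, norm_mul]
      _ ≤ Real.exp (C₀ * t) ^ 2 + Real.exp (C₀ * t) * Real.exp (C₀ * t) := by
          gcongr
      _ = 2 * Real.exp (2 * C₀ * t) := by rw [← Real.exp_add, sq, ← Real.exp_add]; ring_nf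
      _ ≤ Real.exp t * Real.exp (2 * C₀ * t) := by
          gcongr
          have := Real.add_one_le_exp t
          linarith
      _ = Real.exp ((2 * C₀ + 1) * t) := by rw [← Real.exp_add]; ring_nf
      _ ≤ Real.exp ((2 * C₀ + 1 + ‖κ L‖) * t) :=
          Real.exp_le_exp.mpr (by nlinarith [norm_nonneg (κ L)])
  · calc ‖L.weierstrassSigma z‖ ≤ Real.exp (C₀ * t) := hσ
      _ ≤ Real.exp ((2 * C₀ + 1 + ‖κ L‖) * t) :=
          Real.exp_le_exp.mpr (by nlinarith [norm_nonneg (κ L)])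

/-- **Growth of `G_p`.** `‖G_p(z)‖ ≤ ‖p‖ exp(C (D+1)(1 + |z|²))` with `C` depending only on the
lattice (`G_p` has `(D+1)²` terms, each a product of `≤ 3D` factors of order `2`).
[cite: Chudnovsky1984, Ch. 7 Thm 3.1 p. 309] -/
theorem norm_G_le :
    ∃ C : ℝ, 0 ≤ C ∧ ∀ (D : ℕ) (p : Fin (D + 1) × Fin (D + 1) → ℂ) (z : ℂ),
      ‖G L D p z‖ ≤ ‖p‖ * Real.exp (C * (D + 1) * (1 + ‖z‖ ^ 2)) := by
  obtain ⟨C, hC, h⟩ := exists_bound_Sg_Sp_sigma L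
  refine ⟨3 * C + 2, by positivity, fun D p z => ?_⟩
  obtain ⟨h1, h2, h3⟩ := h z
  set t : ℝ := 1 + ‖z‖ ^ 2 with ht
  have ht1 : 1 ≤ t := by nlinarith [norm_nonneg z]
  set E : ℝ := Real.exp (C * t) with hE
  have hE1 : 1 ≤ E := Real.one_le_exp (by positivity)
  -- each term is bounded by `‖p‖ E^{3D}`
  have hterm : ∀ l : Fin (D + 1) × Fin (D + 1),
      ‖p l * (Sg L z ^ (l.1 : ℕ) * Sp L z ^ (l.2 : ℕ) *
        L.weierstrassSigma z ^ (3 * D - l.1 - 2 * l.2))‖ ≤ ‖p‖ * E ^ (3 * D) := by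
    intro l
    have hl1 : (l.1 : ℕ) ≤ D := Nat.lt_succ_iff.mp l.1.isLt
    have hl2 : (l.2 : ℕ) ≤ D := Nat.lt_succ_iff.mp l.2.isLt
    rw [norm_mul, norm_mul, norm_mul, norm_pow, norm_pow, norm_pow]
    have hpow : ‖Sg L z‖ ^ (l.1 : ℕ) * ‖Sp L z‖ ^ (l.2 : ℕ) *
        ‖L.weierstrassSigma z‖ ^ (3 * D - l.1 - 2 * l.2) ≤ E ^ (3 * D) := by
      calc _ ≤ E ^ (l.1 : ℕ) * E ^ (l.2 : ℕ) * E ^ (3 * D - l.1 - 2 * l.2) := by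
            gcongr
          _ = E ^ ((l.1 : ℕ) + l.2 + (3 * D - l.1 - 2 * l.2)) := by rw [pow_add, pow_add]
          _ ≤ E ^ (3 * D) := pow_le_pow_right₀ hE1 (by omega)
    exact mul_le_mul (norm_apply_le p l) hpow (by positivity) (norm_nonneg _)
  have hcard : (Finset.univ : Finset (Fin (D + 1) × Fin (D + 1))).card = (D + 1) ^ 2 := by
    simp [sq]
  have hD1 : ((D + 1 : ℕ) : ℝ) ^ 2 ≤ Real.exp (2 * (D + 1) * t) := by
    have h0 : ((D + 1 : ℕ) : ℝ) ≤ Real.exp ((D + 1 : ℕ) * t) := by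
      calc ((D + 1 : ℕ) : ℝ) ≤ (D + 1 : ℕ) * t := le_mul_of_one_le_right (by positivity) ht1
        _ ≤ (D + 1 : ℕ) * t + 1 := by linarith
        _ ≤ Real.exp ((D + 1 : ℕ) * t) := Real.add_one_le_exp _
    calc ((D + 1 : ℕ) : ℝ) ^ 2 ≤ Real.exp ((D + 1 : ℕ) * t) ^ 2 := by gcongr
      _ = Real.exp (2 * (D + 1) * t) := by rw [sq, ← Real.exp_add]; push_cast; ring_nf
  calc ‖G L D p z‖ ≤ ∑ l, ‖p l * (Sg L z ^ (l.1 : ℕ) * Sp L z ^ (l.2 : ℕ) *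
        L.weierstrassSigma z ^ (3 * D - l.1 - 2 * l.2))‖ := (norm_sum_le _ _)
    _ ≤ ∑ _l : Fin (D + 1) × Fin (D + 1), ‖p‖ * E ^ (3 * D) :=
        (Finset.sum_le_sum fun l _ => hterm l)
    _ = (D + 1 : ℕ) ^ 2 * (‖p‖ * E ^ (3 * D)) := by
        rw [Finset.sum_const, hcard, nsmul_eq_mul]; push_cast; ring
    _ ≤ Real.exp (2 * (D + 1) * t) * (‖p‖ * E ^ (3 * D)) := by gcongr
    _ = ‖p‖ * (Real.exp (2 * (D + 1) * t) * E ^ (3 * D)) := by ring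
    _ ≤ ‖p‖ * Real.exp ((3 * C + 2) * (D + 1) * t) := by
        gcongr
        rw [hE, ← Real.exp_nat_mul, ← Real.exp_add]
        apply Real.exp_le_exp.mpr
        push_cast
        nlinarith

/-! ### The points `s_m + nω₁` and the radius `r₀ X` -/

/-- `r₀ = 2‖ω₁‖ + ‖ω₂‖ + 2`: for `m < X`, `|n| ≤ X` the unit discs around the points
`s_m + nω₁` lie in the disc of radius `r₀ X`. [folklore] -/
def r₀ : ℝ := 2 * ‖L.ω₁‖ + ‖L.ω₂‖ + 2

/-- `2 ≤ r₀`. [folklore] -/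
lemma two_le_r₀ : 2 ≤ r₀ L := by
  unfold r₀; nlinarith [norm_nonneg L.ω₁, norm_nonneg L.ω₂]

/-- `‖s_m + nω₁ + u‖ ≤ r₀ X` for `m < X`, `|n| ≤ X`, `‖u‖ ≤ 1`. [folklore] -/
lemma norm_s_add_le {X : ℕ} (hX : 1 ≤ X) {m : ℕ} (hm : m < X) {n : ℤ} (hn : |(n : ℝ)| ≤ X)
    {u : ℂ} (hu : ‖u‖ ≤ 1) : ‖s L m + n * L.ω₁ + u‖ ≤ r₀ L * X := by
  have hX' : (1 : ℝ) ≤ X := by exact_mod_cast hX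
  have hm' : (m : ℝ) ≤ X := by exact_mod_cast hm.le
  have h1 : ‖s L m + n * L.ω₁ + u‖ ≤ ‖L.ω₁‖ / 2 + m * ‖L.ω₂‖ + |(n : ℝ)| * ‖L.ω₁‖ + 1 := by
    unfold s
    calc ‖L.ω₁ / 2 + m * L.ω₂ + n * L.ω₁ + u‖
        ≤ ‖L.ω₁ / 2‖ + ‖(m : ℂ) * L.ω₂‖ + ‖(n : ℂ) * L.ω₁‖ + ‖u‖ := by
          refine (norm_add_le _ _).trans (add_le_add ((norm_add_le _ _).trans
            (add_le_add (norm_add_le _ _) le_rfl)) le_rfl)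
      _ ≤ ‖L.ω₁‖ / 2 + m * ‖L.ω₂‖ + |(n : ℝ)| * ‖L.ω₁‖ + 1 := by
          gcongr
          · simp
          · rw [norm_mul, Complex.norm_natCast]
          · rw [norm_mul, Complex.norm_intCast]
  calc ‖s L m + n * L.ω₁ + u‖ ≤ ‖L.ω₁‖ / 2 + m * ‖L.ω₂‖ + |(n : ℝ)| * ‖L.ω₁‖ + 1 := h1
    _ ≤ ‖L.ω₁‖ * X + X * ‖L.ω₂‖ + X * ‖L.ω₁‖ + 2 * X := by
        gcongr
        · nlinarith [norm_nonneg L.ω₁]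
        · linarith
    _ = r₀ L * X := by unfold r₀; ring

/-- The points `s_m + nω₁`, `m < X`, `-X ≤ n ≤ X`, as a finite set. [folklore] -/
def zeroPts (X : ℕ) : Finset ℂ :=
  ((Finset.range X) ×ˢ (Finset.Icc (-(X : ℤ)) X)).image fun q => s L q.1 + (q.2 : ℂ) * L.ω₁

/-- The map `(m, n) ↦ s_m + nω₁` is injective (`ω₁, ω₂` are `ℝ`-linearly independent). [folklore] -/
lemma s_add_injective : Function.Injective fun q : ℕ × ℤ => s L q.1 + (q.2 : ℂ) * L.ω₁ := by
  rintro ⟨m, n⟩ ⟨m', n'⟩ h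
  simp only [s] at h
  have h' : ((n : ℝ) - n') • L.ω₁ + ((m : ℝ) - m') • L.ω₂ = 0 := by
    simp only [Complex.real_smul]
    push_cast
    linear_combination h
  obtain ⟨h1, h2⟩ := LinearIndependent.pair_iff.mp L.indep _ _ h'
  have hn : n = n' := by exact_mod_cast sub_eq_zero.mp h1
  have hm : m = m' := by exact_mod_cast sub_eq_zero.mp h2
  rw [hm, hn]

/-- `#zeroPts X = X (2X + 1) ≥ 2X²`. [folklore] -/
lemma two_mul_sq_le_card_zeroPts (X : ℕ) : 2 * X ^ 2 ≤ (zeroPts L X).card := by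
  unfold zeroPts
  rw [Finset.card_image_of_injective _ (s_add_injective L), Finset.card_product,
    Finset.card_range, Int.card_Icc]
  have : (X : ℤ) + 1 - -(X : ℤ) = ((2 * X + 1 : ℕ) : ℤ) := by push_cast; ring
  rw [this, Int.toNat_natCast]
  nlinarith

/-- Membership in `zeroPts`. [folklore] -/
lemma mem_zeroPts {X : ℕ} {x : ℂ} (hx : x ∈ zeroPts L X) :
    ∃ m : ℕ, m < X ∧ ∃ n : ℤ, |(n : ℝ)| ≤ X ∧ x = s L m + n * L.ω₁ := by
  unfold zeroPts at hx
  simp only [Finset.mem_image, Finset.mem_product, Finset.mem_range, Finset.mem_Icc,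
    Prod.exists] at hx
  obtain ⟨m, n, ⟨hm, hn1, hn2⟩, rfl⟩ := hx
  refine ⟨m, hm, n, ?_, rfl⟩
  rw [abs_le]
  exact ⟨by exact_mod_cast hn1, by exact_mod_cast hn2⟩

/-! ### Zeros of high order at the points `s_m` -/

/-- If `F_p^{(j)}(s_m) = 0` for `j < T` then, by `ω₁`-periodicity, the entire function `G_p`
vanishes to order `≥ T` at every `s_m + nω₁`. [folklore] -/
theorem le_analyticOrderAt_G (p : Fin (D + 1) × Fin (D + 1) → ℂ) {T m : ℕ} (n : ℤ)
    (h : ∀ j < T, iteratedDeriv j (F L D p) (s L m) = 0) :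
    (T : ℕ∞) ≤ analyticOrderAt (G L D p) (s L m + n * L.ω₁) := by
  have hc : s L m + n * L.ω₁ ∉ L.lattice := s_add_int_mul_notMem L m n
  have hper : (fun z => F L D p (z + n * L.ω₁)) = F L D p := funext fun z => F_add_int_mul_ω₁ L p z n
  have h1 : ∀ j < T, iteratedDeriv j (F L D p) (s L m + n * L.ω₁) = 0 := by
    intro j hj
    have := congrFun (iteratedDeriv_comp_add_const (n := j) (f := F L D p) (n * L.ω₁)) (s L m)
    rw [hper] at this
    rw [← this, h j hj]
  have h2 : (T : ℕ∞) ≤ analyticOrderAt (F L D p) (s L m + n * L.ω₁) :=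
    (natCast_le_analyticOrderAt_iff_iteratedDeriv_eq_zero (analyticAt_F L p hc)).mpr h1
  have hσ : AnalyticAt ℂ (fun w => L.weierstrassSigma w ^ (3 * D)) (s L m + n * L.ω₁) :=
    ((show Differentiable ℂ L.weierstrassSigma from
      L.differentiable_weierstrassSigma_holds).analyticAt _).pow _
  rw [analyticOrderAt_congr (G_eventuallyEq L hc p), analyticOrderAt_mul hσ (analyticAt_F L p hc)]
  exact le_add_left h2

/-- `2 log 2 ≥ 1`, in the form `(1/2)^{2k} ≤ exp(-k)`. [folklore] -/
lemma half_pow_two_mul_le_exp_neg (k : ℕ) : (1 / 2 : ℝ) ^ (2 * k) ≤ Real.exp (-(k : ℝ)) := by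
  have h2 : (1 / 2 : ℝ) ^ 2 ≤ Real.exp (-1) := by
    have := Real.exp_one_lt_d9
    have h := Real.exp_neg (1 : ℝ)
    rw [h, one_div, inv_pow]
    exact inv_anti₀ (Real.exp_pos 1) (by nlinarith)
  calc (1 / 2 : ℝ) ^ (2 * k) = ((1 / 2 : ℝ) ^ 2) ^ k := by rw [pow_mul]
    _ ≤ Real.exp (-1) ^ k := pow_le_pow_left₀ (by positivity) h2 k
    _ = Real.exp (-(k : ℝ)) := by rw [← Real.exp_nat_mul]; ring_nf

/-- **Schwarz's lemma for `G_p`** (Chudnovsky 1984, Ch. 7, p. 306 and p. 310: "we use Schwarz'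
 lemma applied to the function `σ(z)^{3L} F(z)`"). If `F_p^{(j)}(s_m) = 0` for all `j < T`,
`m < X` (`X ≥ 1`), then for every `ϱ ≥ r₀ X` and `|w| ≤ ϱ`,
`‖G_p(w)‖ ≤ ‖p‖ exp(C (D+1) ϱ²) exp(-T X²)`: `G_p` has `≥ 2X²` zeros of order `≥ T` in the disc
`|z| ≤ ϱ`, and one compares with the circle `|z| = 5ϱ`. [cite: Chudnovsky1984, Ch. 7 Thm 3.1 p. 309] -/
theorem norm_G_le_of_zeros :
    ∃ C : ℝ, 0 ≤ C ∧ ∀ (D X T : ℕ), 1 ≤ X → ∀ p : Fin (D + 1) × Fin (D + 1) → ℂ,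
      (∀ m < X, ∀ j < T, iteratedDeriv j (F L D p) (s L m) = 0) →
      ∀ ϱ : ℝ, r₀ L * X ≤ ϱ → ∀ w : ℂ, ‖w‖ ≤ ϱ →
        ‖G L D p w‖ ≤ ‖p‖ * Real.exp (C * (D + 1) * ϱ ^ 2) * Real.exp (-(T * X ^ 2 : ℝ)) := by
  obtain ⟨C, hC, hG⟩ := norm_G_le L
  refine ⟨26 * C, by positivity, fun D X T hX p hF ϱ hϱ w hw => ?_⟩
  have hX' : (1 : ℝ) ≤ X := by exact_mod_cast hX
  have hϱ2 : 2 ≤ ϱ := by nlinarith [two_le_r₀ L]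
  have hϱ0 : 0 < ϱ := by linarith
  set S := zeroPts L X with hS
  -- norms of the zeros
  have hcS : ∀ x ∈ S, ‖x‖ ≤ ϱ := by
    intro x hx
    obtain ⟨m, hm, n, hn, rfl⟩ := mem_zeroPts L hx
    have := norm_s_add_le L hX hm hn (u := 0) (by simp)
    rw [add_zero] at this
    exact this.trans hϱ
  -- orders of vanishing
  have hord : ∀ x ∈ S, (T : ℕ∞) ≤ analyticOrderAt (G L D p) x := by
    intro x hx
    obtain ⟨m, hm, n, hn, rfl⟩ := mem_zeroPts L hx
    exact le_analyticOrderAt_G L p n (hF m hm)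
  -- the bound on the circle `|z| = 5ϱ`
  set θ : ℝ := ‖p‖ * Real.exp (C * (D + 1) * (1 + (5 * ϱ) ^ 2)) with hθ
  have hθb : ∀ z ∈ sphere (0 : ℂ) (5 * ϱ), ‖G L D p z‖ ≤ θ := by
    intro z hz
    rw [mem_sphere_zero_iff_norm] at hz
    have := hG D p z
    rwa [hz] at this
  -- the lower bound for `∏ (z - c)^T` on the circle and the upper bound at `w`
  have hmF : ∀ z ∈ sphere (0 : ℂ) (5 * ϱ),
      (4 * ϱ) ^ (T * S.card) ≤ ‖∏ x ∈ S, (z - x) ^ T‖ := by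
    intro z hz
    rw [mem_sphere_zero_iff_norm] at hz
    refine Baker1975.Analytic.le_norm_prod_pow S T (by positivity) fun x hx => ?_
    calc 4 * ϱ = 5 * ϱ - ϱ := by ring
      _ ≤ ‖z‖ - ‖x‖ := by rw [hz]; linarith [hcS x hx]
      _ ≤ ‖z - x‖ := norm_sub_norm_le z x
  have hwF : ‖∏ x ∈ S, (w - x) ^ T‖ ≤ (2 * ϱ) ^ (T * S.card) :=
    Baker1975.Analytic.norm_prod_pow_le S T fun x hx =>
      calc ‖w - x‖ ≤ ‖w‖ + ‖x‖ := norm_sub_le w x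
        _ ≤ 2 * ϱ := by linarith [hcS x hx]
  have hm0 : (0 : ℝ) < (4 * ϱ) ^ (T * S.card) := by positivity
  have key := Baker1975.Analytic.norm_le_of_analyticOrderAt (differentiable_G L p) S T hord
    (R := 5 * ϱ) (by positivity) hθb hm0 hmF (w := w) (by linarith)
  -- `θ/(4ϱ)^{T#S} (2ϱ)^{T#S} = θ (1/2)^{T#S} ≤ θ exp(-T X²)`
  have hratio : θ / (4 * ϱ) ^ (T * S.card) * ‖∏ x ∈ S, (w - x) ^ T‖ ≤
      θ * Real.exp (-(T * X ^ 2 : ℝ)) := by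
    have hθ0 : 0 ≤ θ := by positivity
    calc θ / (4 * ϱ) ^ (T * S.card) * ‖∏ x ∈ S, (w - x) ^ T‖
        ≤ θ / (4 * ϱ) ^ (T * S.card) * (2 * ϱ) ^ (T * S.card) := by gcongr
      _ = θ * ((2 * ϱ) / (4 * ϱ)) ^ (T * S.card) := by
          rw [div_pow]; field_simp
      _ = θ * (1 / 2) ^ (T * S.card) := by
          have h12 : (2 * ϱ) / (4 * ϱ) = (1 / 2 : ℝ) := by
            field_simp; ring
          rw [h12]
      _ ≤ θ * (1 / 2) ^ (2 * (T * X ^ 2)) := by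
          refine mul_le_mul_of_nonneg_left ?_ hθ0
          refine pow_le_pow_of_le_one (by norm_num) (by norm_num) ?_
          have := Nat.mul_le_mul_left T (two_mul_sq_le_card_zeroPts L X)
          linarith [show T * (2 * X ^ 2) = 2 * (T * X ^ 2) from by ring]
      _ ≤ θ * Real.exp (-(T * X ^ 2 : ℝ)) := by
          refine mul_le_mul_of_nonneg_left ?_ hθ0
          have := half_pow_two_mul_le_exp_neg (T * X ^ 2)
          push_cast at this
          exact this
  -- the bound for `θ`
  have hθle : θ ≤ ‖p‖ * Real.exp (26 * C * (D + 1) * ϱ ^ 2) := by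
    rw [hθ]
    refine mul_le_mul_of_nonneg_left (Real.exp_le_exp.mpr ?_) (norm_nonneg _)
    have hϱ1 : 1 ≤ ϱ ^ 2 := by nlinarith
    have hD0 : (0 : ℝ) ≤ C * (D + 1) := by positivity
    nlinarith [mul_le_mul_of_nonneg_left hϱ1 hD0]
  calc ‖G L D p w‖ ≤ θ / (4 * ϱ) ^ (T * S.card) * ‖∏ x ∈ S, (w - x) ^ T‖ := key
    _ ≤ θ * Real.exp (-(T * X ^ 2 : ℝ)) := hratio
    _ ≤ ‖p‖ * Real.exp (26 * C * (D + 1) * ϱ ^ 2) * Real.exp (-(T * X ^ 2 : ℝ)) := by gcongr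

/-! ### Division by `σ^{3D}` and Cauchy's inequality -/

/-- `e^a e^{-t} e^b = e^{a+b} e^{-t}`. [folklore] -/
lemma exp_mul_exp_neg_mul_exp (a b t : ℝ) :
    Real.exp a * Real.exp (-t) * Real.exp b = Real.exp (a + b) * Real.exp (-t) := by
  rw [Real.exp_add]; ring

/-- Off the lattice, `‖F_p(z)‖ = ‖G_p(z)‖ / ‖σ(z)‖^{3D}`. [folklore] -/
theorem norm_F_eq {z : ℂ} (hz : z ∉ L.lattice) (p : Fin (D + 1) × Fin (D + 1) → ℂ) :
    ‖F L D p z‖ = ‖G L D p z‖ / ‖L.weierstrassSigma z‖ ^ (3 * D) := by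
  have hσ := L.weierstrassSigma_ne_zero hz
  rw [G_eq L hz p, norm_mul, norm_pow]
  field_simp

/-- Division step: a lower bound `c e^{-C' n²} ≤ ‖σ(z)‖` (`0 < c ≤ 1`, `n ≤ N`, `1 ≤ N`) turns
`‖G_p(z)‖ ≤ A` into `‖F_p(z)‖ ≤ A exp(3 (log c⁻¹ + C') (D+1) N²)`. [folklore] -/
theorem norm_F_le_of_sigma_lower {z : ℂ} (hz : z ∉ L.lattice) (p : Fin (D + 1) × Fin (D + 1) → ℂ)
    {A c₀ C' : ℝ} (hA : ‖G L D p z‖ ≤ A) (hA0 : 0 ≤ A) (hc₀ : 0 < c₀) (hc₁ : c₀ ≤ 1) (hC' : 0 ≤ C')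
    {n N : ℝ} (hn : n ^ 2 ≤ N ^ 2) (hN : 1 ≤ N)
    (hσ : c₀ * Real.exp (-(C' * n ^ 2)) ≤ ‖L.weierstrassSigma z‖) :
    ‖F L D p z‖ ≤ A * Real.exp (3 * (Real.log c₀⁻¹ + C') * (D + 1) * N ^ 2) := by
  rw [norm_F_eq L hz p]
  have hlow : 0 < c₀ * Real.exp (-(C' * n ^ 2)) := by positivity
  have hσpos : 0 < ‖L.weierstrassSigma z‖ := hlow.trans_le hσ
  rw [div_le_iff₀ (pow_pos hσpos _)]
  -- `1 ≤ exp(3 (log c⁻¹ + C') (D+1) N²) · ‖σ z‖^{3D}`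
  have h1 : Real.exp (-(Real.log c₀⁻¹ + C' * N ^ 2)) ≤ ‖L.weierstrassSigma z‖ := by
    refine le_trans ?_ hσ
    rw [neg_add, Real.exp_add, Real.exp_neg, Real.exp_log (by positivity), inv_inv]
    gcongr
  have h2 : Real.exp (-(3 * D * (Real.log c₀⁻¹ + C' * N ^ 2))) ≤ ‖L.weierstrassSigma z‖ ^ (3 * D) := by
    calc Real.exp (-(3 * D * (Real.log c₀⁻¹ + C' * N ^ 2)))
        = Real.exp (-(Real.log c₀⁻¹ + C' * N ^ 2)) ^ (3 * D) := by
          rw [← Real.exp_nat_mul]; push_cast; ring_nf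
      _ ≤ ‖L.weierstrassSigma z‖ ^ (3 * D) := pow_le_pow_left₀ (by positivity) h1 _
  have hlog : 0 ≤ Real.log c₀⁻¹ := Real.log_nonneg (one_le_inv₀ hc₀ |>.mpr hc₁)
  have h3 : 3 * D * (Real.log c₀⁻¹ + C' * N ^ 2) ≤ 3 * (Real.log c₀⁻¹ + C') * (D + 1) * N ^ 2 := by
    have hN1 : 1 ≤ N ^ 2 := by nlinarith
    have hD : (0 : ℝ) ≤ D := by positivity
    nlinarith [mul_nonneg hD hlog, mul_nonneg hD hC']
  calc ‖G L D p z‖ ≤ A := hA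
    _ = A * (Real.exp (3 * (Real.log c₀⁻¹ + C') * (D + 1) * N ^ 2) *
        Real.exp (-(3 * (Real.log c₀⁻¹ + C') * (D + 1) * N ^ 2))) := by
          rw [← Real.exp_add, add_neg_cancel, Real.exp_zero, mul_one]
    _ ≤ A * (Real.exp (3 * (Real.log c₀⁻¹ + C') * (D + 1) * N ^ 2) *
        Real.exp (-(3 * D * (Real.log c₀⁻¹ + C' * N ^ 2)))) := by
          gcongr
    _ ≤ A * (Real.exp (3 * (Real.log c₀⁻¹ + C') * (D + 1) * N ^ 2) *
        ‖L.weierstrassSigma z‖ ^ (3 * D)) := by gcongr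
    _ = A * Real.exp (3 * (Real.log c₀⁻¹ + C') * (D + 1) * N ^ 2) *
        ‖L.weierstrassSigma z‖ ^ (3 * D) := by ring

/-- A closed disc around `ω₁/2` missing the lattice, of radius `≤ 1`. [folklore] -/
theorem exists_closedBall_subset_compl_lattice :
    ∃ δ : ℝ, 0 < δ ∧ δ ≤ 1 ∧ closedBall (L.ω₁ / 2) δ ⊆ (L.lattice : Set ℂ)ᶜ := by
  have h := L.isClosed_lattice.isOpen_compl.mem_nhds L.ω₁_div_two_notMem_lattice
  obtain ⟨ε, hε, hball⟩ := Metric.nhds_basis_closedBall.mem_iff.mp h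
  exact ⟨min ε 1, by positivity, min_le_right _ _,
    (closedBall_subset_closedBall (min_le_left _ _)).trans hball⟩

/-- **The fundamental upper bound** (Chudnovsky 1984, Ch. 7, (2.5) p. 306 and p. 310). If
`F_p^{(j)}(s_m) = 0` for `j < T`, `m < X` (`X ≥ 1`), then for every `m₀ < X` and every `j`,
`|F_p^{(j)}(s_{m₀})| ≤ ‖p‖ · j! · exp(C ((D+1) X² + j)) · exp(-T X²)`, by Schwarz's lemma for
`G_p`, division by `σ^{3D}` on a small circle around `s_{m₀}` and Cauchy's inequality.
[cite: Chudnovsky1984, Ch. 7 Thm 3.1 p. 309] -/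
theorem norm_iteratedDeriv_F_le_of_zeros :
    ∃ C : ℝ, 0 ≤ C ∧ ∀ (D X T : ℕ), 1 ≤ X → ∀ p : Fin (D + 1) × Fin (D + 1) → ℂ,
      (∀ m < X, ∀ j < T, iteratedDeriv j (F L D p) (s L m) = 0) →
      ∀ m₀ < X, ∀ j : ℕ,
        ‖iteratedDeriv j (F L D p) (s L m₀)‖ ≤
          ‖p‖ * j.factorial * Real.exp (C * ((D + 1) * X ^ 2 + j)) * Real.exp (-(T * X ^ 2 : ℝ)) := by
  obtain ⟨δ, hδ, hδ1, hball⟩ := exists_closedBall_subset_compl_lattice L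
  obtain ⟨CA, hCA, hA⟩ := norm_G_le_of_zeros L
  have hKc : IsCompact (sphere (L.ω₁ / 2) δ) := isCompact_sphere _ _
  have hKΛ : ∀ k ∈ sphere (L.ω₁ / 2) δ, k ∉ L.lattice := fun k hk => hball (sphere_subset_closedBall hk)
  obtain ⟨c₁, hc₁, C₁, hC₁, hlow⟩ := le_norm_weierstrassSigma_add_nat_mul_ω₂ L hKc hKΛ
  -- WLOG `c₁ ≤ 1`
  set c₀ := min c₁ 1 with hc₀def
  have hc₀ : 0 < c₀ := by positivity
  have hc₀1 : c₀ ≤ 1 := min_le_right _ _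
  have hlog : 0 ≤ Real.log c₀⁻¹ := Real.log_nonneg (one_le_inv₀ hc₀ |>.mpr hc₀1)
  have hlogδ : 0 ≤ Real.log δ⁻¹ := Real.log_nonneg (one_le_inv₀ hδ |>.mpr hδ1)
  refine ⟨CA * r₀ L ^ 2 + 3 * (Real.log c₀⁻¹ + C₁) + Real.log δ⁻¹, by positivity,
    fun D X T hX p hF m₀ hm₀ j => ?_⟩
  have hX' : (1 : ℝ) ≤ X := by exact_mod_cast hX
  -- the bound on the circle `|w - s_{m₀}| = δ`
  set A : ℝ := ‖p‖ * Real.exp (CA * (D + 1) * (r₀ L * X) ^ 2) * Real.exp (-(T * X ^ 2 : ℝ)) with hAdef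
  have hA0 : 0 ≤ A := by positivity
  set B : ℝ := A * Real.exp (3 * (Real.log c₀⁻¹ + C₁) * (D + 1) * (X : ℝ) ^ 2) with hBdef
  have hsphere : ∀ w ∈ sphere (s L m₀) δ, ‖F L D p w‖ ≤ B := by
    intro w hw
    have hk : w - m₀ * L.ω₂ ∈ sphere (L.ω₁ / 2) δ := by
      rw [mem_sphere_iff_norm] at hw ⊢
      rw [← hw]; congr 1; unfold s; ring
    have hwΛ : w ∉ L.lattice := by
      intro h
      exact hKΛ _ hk (by simpa using sub_mem h (nat_mul_ω₂_mem L m₀))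
    have hσ : c₀ * Real.exp (-(C₁ * (m₀ : ℝ) ^ 2)) ≤ ‖L.weierstrassSigma w‖ := by
      have := hlow _ hk m₀
      rw [sub_add_cancel] at this
      refine le_trans ?_ this
      gcongr
      exact min_le_left _ _
    have hwn : ‖w‖ ≤ r₀ L * X := by
      have := norm_s_add_le L hX hm₀ (n := 0) (by simp) (u := w - s L m₀)
        (by rw [mem_sphere_iff_norm] at hw; rw [hw]; exact hδ1)
      simpa using this
    have hG : ‖G L D p w‖ ≤ A := hA D X T hX p hF (r₀ L * X) le_rfl w hwn
    have hm₀' : (m₀ : ℝ) ^ 2 ≤ (X : ℝ) ^ 2 := by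
      have : (m₀ : ℝ) ≤ X := by exact_mod_cast hm₀.le
      nlinarith
    exact norm_F_le_of_sigma_lower L hwΛ p hG hA0 hc₀ hc₀1 hC₁ hm₀' hX' hσ
  -- Cauchy's inequality
  have hdiff : DiffContOnCl ℂ (F L D p) (ball (s L m₀) δ) := by
    refine DifferentiableOn.diffContOnCl fun w hw => ?_
    have hw' : w ∈ closedBall (s L m₀) δ := closure_ball_subset_closedBall hw
    have hk : w - m₀ * L.ω₂ ∈ closedBall (L.ω₁ / 2) δ := by
      rw [mem_closedBall_iff_norm] at hw' ⊢
      refine le_trans (le_of_eq ?_) hw'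
      congr 1; unfold s; ring
    have hwΛ : w ∉ L.lattice := by
      intro h
      exact hball hk (by simpa using sub_mem h (nat_mul_ω₂_mem L m₀))
    exact (analyticAt_F L p hwΛ).differentiableAt.differentiableWithinAt
  have hC := Complex.norm_iteratedDeriv_le_of_forall_mem_sphere_norm_le j hδ hdiff hsphere
  -- bookkeeping
  have hB : B ≤ ‖p‖ * Real.exp ((CA * r₀ L ^ 2 + 3 * (Real.log c₀⁻¹ + C₁)) * ((D + 1) * X ^ 2)) *
      Real.exp (-(T * X ^ 2 : ℝ)) := by
    rw [hBdef, hAdef, mul_assoc ‖p‖, mul_assoc ‖p‖, exp_mul_exp_neg_mul_exp, ← mul_assoc]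
    refine le_of_eq ?_
    congr 3; ring
  have hδj : (δ ^ j)⁻¹ ≤ Real.exp (Real.log δ⁻¹ * j) := by
    rw [mul_comm, Real.exp_nat_mul, Real.exp_log (inv_pos.mpr hδ), inv_pow]
  set Ctot := CA * r₀ L ^ 2 + 3 * (Real.log c₀⁻¹ + C₁) + Real.log δ⁻¹ with hCtot
  calc ‖iteratedDeriv j (F L D p) (s L m₀)‖ ≤ j.factorial * B / δ ^ j := hC
    _ = j.factorial * B * (δ ^ j)⁻¹ := by rw [div_eq_mul_inv]
    _ ≤ j.factorial * (‖p‖ * Real.exp ((CA * r₀ L ^ 2 + 3 * (Real.log c₀⁻¹ + C₁)) *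
        ((D + 1) * X ^ 2)) * Real.exp (-(T * X ^ 2 : ℝ))) * Real.exp (Real.log δ⁻¹ * j) := by
        gcongr
    _ = ‖p‖ * j.factorial * Real.exp ((CA * r₀ L ^ 2 + 3 * (Real.log c₀⁻¹ + C₁)) *
        ((D + 1) * X ^ 2) + Real.log δ⁻¹ * j) * Real.exp (-(T * X ^ 2 : ℝ)) := by
        rw [Real.exp_add]; ring
    _ ≤ ‖p‖ * j.factorial * Real.exp (Ctot * ((D + 1) * X ^ 2 + j)) *
        Real.exp (-(T * X ^ 2 : ℝ)) := by
        gcongr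
        rw [hCtot]
        have h1 : (0 : ℝ) ≤ (D + 1) * X ^ 2 := by positivity
        have h2 : (0 : ℝ) ≤ j := by positivity
        have h3 : 0 ≤ CA * r₀ L ^ 2 + 3 * (Real.log c₀⁻¹ + C₁) := by positivity
        nlinarith [mul_nonneg hlogδ h1, mul_nonneg h3 h2]

/-! ### Input for the zero estimate: smallness on `ω₂`-translates of a disc, open mapping -/

/-- `℘` is not locally constant at `ω₁/2` (it has a double pole at `0` and `ℂ ∖ Λ` is connected).
[folklore] -/
theorem not_eventually_const_weierstrassP :
    ¬ (∀ᶠ w in 𝓝 (L.ω₁ / 2), ℘[L] w = ℘[L] (L.ω₁ / 2)) := by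
  intro h
  -- `℘ = e₁` on the connected open set `Λᶜ`
  have hU : IsPreconnected ((L.lattice : Set ℂ)ᶜ) := L.isPreconnected_compl_lattice
  have h0 : L.ω₁ / 2 ∈ (L.lattice : Set ℂ)ᶜ := L.ω₁_div_two_notMem_lattice
  have heq : Set.EqOn ℘[L] (fun _ => ℘[L] (L.ω₁ / 2)) (L.lattice : Set ℂ)ᶜ :=
    L.analyticOnNhd_weierstrassP.eqOn_of_preconnected_of_eventuallyEq analyticOnNhd_const hU h0 h
  -- hence on a punctured neighbourhood of `0`
  have hev : ℘[L] =ᶠ[𝓝[≠] (0 : ℂ)] fun _ => ℘[L] (L.ω₁ / 2) := by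
    have h1 : ((L.lattice : Set ℂ) \ {0})ᶜ ∈ 𝓝 (0 : ℂ) := L.compl_lattice_sdiff_singleton_mem_nhds 0
    rw [eventuallyEq_nhdsWithin_iff]
    filter_upwards [h1] with w hw hw0
    exact heq fun hwΛ => hw ⟨hwΛ, hw0⟩
  have hord := L.order_weierstrassP 0 (zero_mem _)
  have h2 : (-2 : WithTop ℤ) = ((-2 : ℤ) : WithTop ℤ) := by norm_num
  rw [meromorphicOrderAt_congr hev, meromorphicOrderAt_const, h2] at hord
  split_ifs at hord
  · exact WithTop.top_ne_coe hord
  · simp at hord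

/-- **Smallness on translates** (input of the zero estimate). There are a closed disc
`B = closedBall (ω₁/2) δ` (`0 < δ ≤ 1`) missing the lattice, whose image under `℘` contains a disc
around `e₁`, and a constant `C` such that: if `F_p^{(j)}(s_m) = 0` for `j < T`, `m < X`
(`X ≥ 1`), then `‖F_p(z + mω₂)‖ ≤ ‖p‖ exp(C (D+1)(X+M)²) exp(-T X²)` for `z ∈ B`, `m ≤ M`.
[cite: Chudnovsky1984, Ch. 7 Lemma 3.2 p. 310] -/
theorem norm_F_translate_le_of_zeros :
    ∃ δ : ℝ, 0 < δ ∧ δ ≤ 1 ∧ closedBall (L.ω₁ / 2) δ ⊆ (L.lattice : Set ℂ)ᶜ ∧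
      (∃ ρ : ℝ, 0 < ρ ∧ ball (e₁ L) ρ ⊆ ℘[L] '' closedBall (L.ω₁ / 2) δ) ∧
      ∃ C : ℝ, 0 ≤ C ∧ ∀ (D X T : ℕ), 1 ≤ X → ∀ p : Fin (D + 1) × Fin (D + 1) → ℂ,
        (∀ m < X, ∀ j < T, iteratedDeriv j (F L D p) (s L m) = 0) →
        ∀ (M : ℕ) (z : ℂ), z ∈ closedBall (L.ω₁ / 2) δ → ∀ m : ℕ, m ≤ M →
          ‖F L D p (z + m * L.ω₂)‖ ≤
            ‖p‖ * Real.exp (C * (D + 1) * ((X : ℝ) + M) ^ 2) * Real.exp (-(T * X ^ 2 : ℝ)) := by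
  obtain ⟨δ, hδ, hδ1, hball⟩ := exists_closedBall_subset_compl_lattice L
  refine ⟨δ, hδ, hδ1, hball, ?_, ?_⟩
  · -- open mapping at `ω₁/2`
    have han : AnalyticAt ℂ ℘[L] (L.ω₁ / 2) := L.analyticOnNhd_weierstrassP _ L.ω₁_div_two_notMem_lattice
    have hle := (han.eventually_constant_or_nhds_le_map_nhds).resolve_left
      (not_eventually_const_weierstrassP L)
    have hmem : ℘[L] '' closedBall (L.ω₁ / 2) δ ∈ 𝓝 (e₁ L) :=
      hle (Filter.image_mem_map (closedBall_mem_nhds _ hδ))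
    obtain ⟨ρ, hρ, hsub⟩ := Metric.mem_nhds_iff.mp hmem
    exact ⟨ρ, hρ, hsub⟩
  · obtain ⟨CA, hCA, hA⟩ := norm_G_le_of_zeros L
    have hKc : IsCompact (closedBall (L.ω₁ / 2) δ) := isCompact_closedBall _ _
    have hKΛ : ∀ k ∈ closedBall (L.ω₁ / 2) δ, k ∉ L.lattice := fun k hk => hball hk
    obtain ⟨c₁, hc₁, C₁, hC₁, hlow⟩ := le_norm_weierstrassSigma_add_nat_mul_ω₂ L hKc hKΛ
    set c₀ := min c₁ 1 with hc₀def
    have hc₀ : 0 < c₀ := by positivity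
    have hc₀1 : c₀ ≤ 1 := min_le_right _ _
    have hlog : 0 ≤ Real.log c₀⁻¹ := Real.log_nonneg (one_le_inv₀ hc₀ |>.mpr hc₀1)
    refine ⟨CA * r₀ L ^ 2 + 3 * (Real.log c₀⁻¹ + C₁), by positivity,
      fun D X T hX p hF M z hz m hm => ?_⟩
    have hX' : (1 : ℝ) ≤ X := by exact_mod_cast hX
    set N : ℝ := (X : ℝ) + M with hN
    have hN1 : 1 ≤ N := by rw [hN]; linarith [(Nat.cast_nonneg M : (0 : ℝ) ≤ M)]
    have hzΛ : z + m * L.ω₂ ∉ L.lattice := add_notMem L (hKΛ z hz) (nat_mul_ω₂_mem L m)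
    -- `‖z + mω₂‖ ≤ r₀ (X + M)`
    have hnorm : ‖z + m * L.ω₂‖ ≤ r₀ L * N := by
      have hz' : ‖z - L.ω₁ / 2‖ ≤ δ := mem_closedBall_iff_norm.mp hz
      have hm' : (m : ℝ) ≤ M := by exact_mod_cast hm
      calc ‖z + m * L.ω₂‖ = ‖L.ω₁ / 2 + (z - L.ω₁ / 2) + m * L.ω₂‖ := by ring_nf
        _ ≤ ‖L.ω₁ / 2‖ + ‖z - L.ω₁ / 2‖ + ‖(m : ℂ) * L.ω₂‖ :=
            (norm_add_le _ _).trans (add_le_add (norm_add_le _ _) le_rfl)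
        _ ≤ ‖L.ω₁‖ / 2 + 1 + M * ‖L.ω₂‖ := by
            gcongr
            · simp
            · exact hz'.trans hδ1
            · rw [norm_mul, Complex.norm_natCast]; gcongr
        _ ≤ r₀ L * N := by
            rw [hN]; unfold r₀
            nlinarith [norm_nonneg L.ω₁, norm_nonneg L.ω₂, (Nat.cast_nonneg M : (0 : ℝ) ≤ M)]
    have hϱ : r₀ L * X ≤ r₀ L * N := by
      rw [hN]; gcongr
      · linarith [two_le_r₀ L]
      · linarith [(Nat.cast_nonneg M : (0 : ℝ) ≤ M)]
    have hG : ‖G L D p (z + m * L.ω₂)‖ ≤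
        ‖p‖ * Real.exp (CA * (D + 1) * (r₀ L * N) ^ 2) * Real.exp (-(T * X ^ 2 : ℝ)) :=
      hA D X T hX p hF _ hϱ _ hnorm
    have hσ : c₀ * Real.exp (-(C₁ * (m : ℝ) ^ 2)) ≤ ‖L.weierstrassSigma (z + m * L.ω₂)‖ := by
      refine le_trans ?_ (hlow z hz m)
      gcongr
      exact min_le_left _ _
    have hm2 : (m : ℝ) ^ 2 ≤ N ^ 2 := by
      have hmM : (m : ℝ) ≤ M := by exact_mod_cast hm
      have : (m : ℝ) ≤ N := by rw [hN]; linarith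
      nlinarith
    have key := norm_F_le_of_sigma_lower L hzΛ p hG (by positivity) hc₀ hc₀1 hC₁ hm2 hN1 hσ
    refine key.trans (le_of_eq ?_)
    rw [mul_assoc ‖p‖, mul_assoc ‖p‖, exp_mul_exp_neg_mul_exp, ← mul_assoc, hN]
    congr 3; ring

/-! ## Part II — differential algebra of `g, ℘, ℘'` and the formal values -/

section DifferentialAlgebra

open MvPolynomial

/-! ### The derivation `D_{a,b}` -/

section Derivation

variable {R S : Type*} [CommRing R] [CommRing S]

/-- The values of `D_{a,b}` on the variables: `D X₀ = -X₁ - a`, `D X₁ = X₂`, `D X₂ = 6X₁² - b`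
(`X₀ ↔ g = ζ - κz`, `X₁ ↔ ℘`, `X₂ ↔ ℘'`; `a ↔ κ`, `b ↔ g₂/2`). [cite: Chudnovsky1984, Ch. 7 §2 p. 306] -/
def chudDVal (a b : R) : Fin 3 → MvPolynomial (Fin 3) R :=
  ![-X 1 - C a, X 2, 6 * X 1 ^ 2 - C b]

/-- The derivation `D_{a,b} = (-X₁ - a)∂₀ + X₂ ∂₁ + (6X₁² - b)∂₂` of `R[X₀, X₁, X₂]`, the
algebraic form of `d/dz` on `R[ζ - κz, ℘, ℘']`. [cite: Chudnovsky1984, Ch. 7 §2 p. 306] -/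
def chudD (a b : R) : Derivation R (MvPolynomial (Fin 3) R) (MvPolynomial (Fin 3) R) :=
  MvPolynomial.mkDerivation R (chudDVal a b)

/-- `D X_i` is the prescribed value. [folklore] -/
@[simp] lemma chudD_X (a b : R) (i : Fin 3) : chudD a b (X i) = chudDVal a b i :=
  MvPolynomial.mkDerivation_X _ _ _

/-- `D (C r) = 0`. [folklore] -/
@[simp] lemma chudD_C (a b : R) (r : R) : chudD a b (C r) = 0 :=
  MvPolynomial.derivation_C _ _

end Derivation

/-! ### `℘'' = 6℘² - g₂/2` and the chain rule -/

variable (L : PeriodPair)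

/-- `g' = -℘ - κ` off the lattice. [folklore] -/
theorem hasDerivAt_g {z : ℂ} (hz : z ∉ L.lattice) : HasDerivAt (g L) (-℘[L] z - κ L) z := by
  have hζ : HasDerivAt L.weierstrassZeta (-℘[L] z) z := by
    have hd : DifferentiableAt ℂ L.weierstrassZeta z :=
      L.differentiableOn_weierstrassZeta_holds.differentiableAt
        (L.isClosed_lattice.isOpen_compl.mem_nhds hz)
    rw [← L.deriv_weierstrassZeta_holds z hz]
    exact hd.hasDerivAt
  unfold g
  have h2 : HasDerivAt (fun w => κ L * w) (κ L) z := by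
    simpa using (hasDerivAt_id z).const_mul (κ L)
  exact hζ.sub h2

/-- The vector of functions `(g, ℘, ℘')` at `z`. [folklore] -/
def v (z : ℂ) : Fin 3 → ℂ := ![g L z, ℘[L] z, ℘'[L] z]

/-- `v 0 = g`. [folklore] -/
@[simp] lemma v_zero (z : ℂ) : v L z 0 = g L z := rfl
/-- `v 1 = ℘`. [folklore] -/
@[simp] lemma v_one (z : ℂ) : v L z 1 = ℘[L] z := rfl
/-- `v 2 = ℘'`. [folklore] -/
@[simp] lemma v_two (z : ℂ) : v L z 2 = ℘'[L] z := rfl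

/-- `v(s_m) = (mc, e₁, 0)`. [folklore] -/
theorem v_s (m : ℕ) : v L (s L m) = ![(m : ℂ) * c L, e₁ L, 0] := by
  ext i
  fin_cases i
  · exact g_s L m
  · exact weierstrassP_s L m
  · exact derivWeierstrassP_s L m

/-- The derivation `D = D_{κ, g₂/2}` over `ℂ`. [cite: Chudnovsky1984, Ch. 7 §2 p. 306] -/
abbrev Dℂ : Derivation ℂ (MvPolynomial (Fin 3) ℂ) (MvPolynomial (Fin 3) ℂ) :=
  chudD (κ L) (L.g₂ / 2)

/-- The variables satisfy the chain rule: `d/dz (v z i) = (D X_i)(v z)`. [folklore] -/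
theorem hasDerivAt_v {z : ℂ} (hz : z ∉ L.lattice) (i : Fin 3) :
    HasDerivAt (fun w => v L w i) (eval (v L z) (Dℂ L (X i))) z := by
  fin_cases i
  · simpa [chudDVal] using hasDerivAt_g L hz
  · simpa [chudDVal] using L.hasDerivAt_weierstrassP hz
  · have hd : HasDerivAt ℘'[L] (deriv ℘'[L] z) z :=
      ((L.analyticOnNhd_derivWeierstrassP z hz).differentiableAt).hasDerivAt
    rw [L.deriv_derivWeierstrassP hz] at hd
    simpa [chudDVal] using hd

/-- **Chain rule**: `d/dz P(g, ℘, ℘')(z) = (D P)(g, ℘, ℘')(z)` for `z ∉ Λ`.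
[cite: Chudnovsky1984, Ch. 7 §2 p. 306] -/
theorem hasDerivAt_eval_v (P : MvPolynomial (Fin 3) ℂ) {z : ℂ} (hz : z ∉ L.lattice) :
    HasDerivAt (fun w => eval (v L w) P) (eval (v L z) (Dℂ L P)) z := by
  induction P using MvPolynomial.induction_on with
  | C r => simpa using hasDerivAt_const z r
  | add p q hp hq =>
    simp only [map_add]
    exact hp.add hq
  | mul_X p i hp =>
    have hi := hasDerivAt_v L hz i
    have := hp.mul hi
    simp only [map_mul, eval_X]
    refine this.congr_deriv ?_
    rw [Derivation.leibniz]
    simp only [smul_eq_mul, map_add, map_mul, eval_X]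
    ring

/-- Iterated chain rule: `(d/dz)^k P(g, ℘, ℘')(z) = (D^k P)(g, ℘, ℘')(z)` for `z ∉ Λ`.
[cite: Chudnovsky1984, Ch. 7 §2 p. 306] -/
theorem iteratedDeriv_eval_v (k : ℕ) (P : MvPolynomial (Fin 3) ℂ) {z : ℂ} (hz : z ∉ L.lattice) :
    iteratedDeriv k (fun w => eval (v L w) P) z = eval (v L z) (((Dℂ L).toLinearMap ^ k) P) := by
  induction k generalizing z with
  | zero => simp
  | succ k ih =>
    rw [iteratedDeriv_succ, pow_succ', Module.End.mul_apply]
    have hev : iteratedDeriv k (fun w => eval (v L w) P) =ᶠ[𝓝 z]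
        fun w => eval (v L w) (((Dℂ L).toLinearMap ^ k) P) := by
      filter_upwards [L.isClosed_lattice.isOpen_compl.mem_nhds hz] with w hw
      exact ih hw
    rw [hev.deriv_eq]
    exact (hasDerivAt_eval_v L _ hz).deriv

/-! ### The auxiliary function as a polynomial in `(g, ℘)` -/

/-- The polynomial `∑ p (i,k) X₀ⁱ X₁ᵏ ∈ ℂ[X₀, X₁, X₂]` of a coefficient family `p`. [folklore] -/
def toPoly {D : ℕ} (p : Fin (D + 1) × Fin (D + 1) → ℂ) : MvPolynomial (Fin 3) ℂ :=
  ∑ l, C (p l) * (X 0 ^ (l.1 : ℕ) * X 1 ^ (l.2 : ℕ))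

/-- `F_p(z) = (toPoly p)(g(z), ℘(z), ℘'(z))`. [folklore] -/
theorem F_eq_eval_toPoly {D : ℕ} (p : Fin (D + 1) × Fin (D + 1) → ℂ) (z : ℂ) :
    F L D p z = eval (v L z) (toPoly p) := by
  unfold F toPoly
  simp [map_mul, eval_C, eval_pow, eval_X]

/-- The derivatives of `F_p` at `s_m`:
`F_p^{(j)}(s_m) = ∑ p (i,k) · (D^j X₀ⁱX₁ᵏ)(mc, e₁, 0)`. [cite: Chudnovsky1984, Ch. 7 §2 p. 306] -/
theorem iteratedDeriv_F_s_eq_sum {D : ℕ} (p : Fin (D + 1) × Fin (D + 1) → ℂ) (j m : ℕ) :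
    iteratedDeriv j (F L D p) (s L m) =
      ∑ l, p l * eval ![(m : ℂ) * c L, e₁ L, 0]
        (((Dℂ L).toLinearMap ^ j) (X 0 ^ (l.1 : ℕ) * X 1 ^ (l.2 : ℕ))) := by
  have hF : F L D p = fun w => eval (v L w) (toPoly p) := funext (F_eq_eval_toPoly L p)
  rw [hF, iteratedDeriv_eval_v L j _ (s_notMem L m), v_s]
  unfold toPoly
  simp only [map_sum]
  refine Finset.sum_congr rfl fun l _ => ?_
  have : C (p l) * (X 0 ^ (l.1 : ℕ) * X 1 ^ (l.2 : ℕ)) =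
      p l • (X 0 ^ (l.1 : ℕ) * X 1 ^ (l.2 : ℕ) : MvPolynomial (Fin 3) ℂ) := by
    rw [smul_eq_C_mul]
  rw [this, map_smul, smul_eq_C_mul, map_mul, eval_C]

/-! ### The formal side: integer polynomials in `(X₀, X₁, X₂; a₀, …, a₃)` -/

/-- The coefficient ring `R₄ = ℤ[a₀, a₁, a₂, a₃]` of the formal computation
(`a₀ ↔ κ`, `a₁ ↔ g₂/2`, `a₂ ↔ c`, `a₃ ↔ e₁`). [folklore] -/
abbrev R₄ : Type := MvPolynomial (Fin 4) ℤ

/-- The flat formal ring `R₇ = ℤ[X₀, X₁, X₂; a₀, …, a₃]` (variables `Sum.inl i ↔ Xᵢ`,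
`Sum.inr l ↔ a_l`), in which the formal derivatives are computed and their degrees and heights
are measured. [folklore] -/
abbrev R₇ : Type := MvPolynomial (Fin 3 ⊕ Fin 4) ℤ

/-- The values of the formal derivation on the variables: `D X₀ = -X₁ - a₀`, `D X₁ = X₂`,
`D X₂ = 6X₁² - a₁`, `D a_l = 0`. [cite: Chudnovsky1984, Ch. 7 §2 p. 306] -/
def dval : Fin 3 ⊕ Fin 4 → R₇ :=
  Sum.elim ![-X (Sum.inl 1) - X (Sum.inr 0), X (Sum.inl 2), 6 * X (Sum.inl 1) ^ 2 - X (Sum.inr 1)] 0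

/-- The formal derivation `D₀` of `ℤ[X; a]` (`= D_{a₀, a₁}` with the `a_l` treated as constants).
[cite: Chudnovsky1984, Ch. 7 §2 p. 306] -/
def D₀ : Derivation ℤ R₇ R₇ := MvPolynomial.mkDerivation ℤ dval

/-- `D₀ X_s = dval s`. [folklore] -/
@[simp] lemma D₀_X (s : Fin 3 ⊕ Fin 4) : D₀ (X s) = dval s :=
  MvPolynomial.mkDerivation_X _ _ _

/-- The substitution at the point `s_m`: `X₀ ↦ m a₂`, `X₁ ↦ a₃`, `X₂ ↦ 0`, `a_l ↦ a_l`
(`g(s_m) = mc`, `℘(s_m) = e₁`, `℘'(s_m) = 0`). [folklore] -/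
def sval (m : ℕ) : Fin 3 ⊕ Fin 4 → R₄ := Sum.elim ![(m : R₄) * X 2, X 3, 0] X

/-- The integer polynomials `V j m i k = (D₀^j (X₀ⁱ X₁ᵏ))(m a₂, a₃, 0; a) ∈ ℤ[a₀, …, a₃]`: the
formal values of `(d/dz)^j (gⁱ ℘ᵏ)` at `s_m`. [cite: Chudnovsky1984, Ch. 7 §2 p. 306] -/
def V (j m i k : ℕ) : R₄ :=
  MvPolynomial.aeval (sval m) ((D₀.toLinearMap ^ j) (X (Sum.inl 0) ^ i * X (Sum.inl 1) ^ k))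

/-- The numbers `x = (κ, g₂/2, c, e₁)` substituted for `(a₀, …, a₃)`. [folklore] -/
def xv : Fin 4 → ℂ := ![κ L, L.g₂ / 2, c L, e₁ L]

/-- The specialisation `ℤ[a] → ℂ`, `a ↦ x`. [folklore] -/
abbrev φx : R₄ →+* ℂ := (MvPolynomial.aeval (xv L) : R₄ →ₐ[ℤ] ℂ).toRingHom

/-- `φx a₀ = κ`. [folklore] -/
@[simp] lemma φx_X0 : φx L (X 0) = κ L := by simp [φx, xv]
/-- `φx a₁ = g₂/2`. [folklore] -/
@[simp] lemma φx_X1 : φx L (X 1) = L.g₂ / 2 := by simp [φx, xv]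
/-- `φx a₂ = c`. [folklore] -/
@[simp] lemma φx_X2 : φx L (X 2) = c L := by simp [φx, xv]
/-- `φx a₃ = e₁`. [folklore] -/
@[simp] lemma φx_X3 : φx L (X 3) = e₁ L := by simp [φx, xv]

/-- The specialisation of the constants `ℤ[X; a] → ℂ[X]`, `a ↦ x`, `Xᵢ ↦ Xᵢ`. [folklore] -/
abbrev ψx : R₇ →ₐ[ℤ] MvPolynomial (Fin 3) ℂ :=
  MvPolynomial.aeval (Sum.elim X fun l => C (xv L l))

/-- `ψx` intertwines the values of the two derivations on the variables. [folklore] -/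
lemma ψx_dval (s : Fin 3 ⊕ Fin 4) : ψx L (dval s) = Dℂ L (ψx L (X s)) := by
  rcases s with s | l
  · fin_cases s <;> simp [dval, chudDVal, xv, map_sub, map_neg]
  · simp [dval]

/-- **Specialisation commutes with derivation**: `ψx (D₀ Q) = D (ψx Q)`. [folklore] -/
theorem ψx_D₀ (Q : R₇) : ψx L (D₀ Q) = Dℂ L (ψx L Q) := by
  induction Q using MvPolynomial.induction_on with
  | C r =>
    rw [D₀, MvPolynomial.derivation_C, map_zero, MvPolynomial.aeval_C, eq_intCast,
      Derivation.map_intCast]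
  | add p q hp hq => simp only [map_add, hp, hq]
  | mul_X p s hp =>
    rw [Derivation.leibniz, smul_eq_mul, smul_eq_mul, map_add, map_mul, map_mul, hp, D₀_X,
      ψx_dval, map_mul, (Dℂ L).leibniz, smul_eq_mul, smul_eq_mul]

/-- The same for the iterates. [folklore] -/
theorem ψx_D₀_pow (j : ℕ) (Q : R₇) :
    ψx L ((D₀.toLinearMap ^ j) Q) = ((Dℂ L).toLinearMap ^ j) (ψx L Q) := by
  induction j generalizing Q with
  | zero => simp
  | succ j ih =>
    rw [pow_succ, pow_succ, Module.End.mul_apply, Module.End.mul_apply, ih]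
    exact congrArg _ (ψx_D₀ L Q)

/-- Compatibility of the two evaluations at `s_m`: `φx (Q(m a₂, a₃, 0; a)) = (ψx Q)(mc, e₁, 0)`.
[folklore] -/
lemma φx_aeval_sval (m : ℕ) (Q : R₇) :
    φx L (MvPolynomial.aeval (sval m) Q) = eval ![(m : ℂ) * c L, e₁ L, 0] (ψx L Q) := by
  change ((φx L).comp (MvPolynomial.aeval (sval m) : R₇ →ₐ[ℤ] R₄).toRingHom) Q =
    ((MvPolynomial.eval ![(m : ℂ) * c L, e₁ L, 0]).comp (ψx L).toRingHom) Q
  congr 1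
  refine MvPolynomial.ringHom_ext (fun r => by simp) (fun s => ?_)
  rcases s with s | l
  · fin_cases s <;> simp [sval, xv]
  · fin_cases l <;> simp [sval, xv]

/-- Specialising the formal value gives the complex value:
`φx (V j m i k) = (D^j X₀ⁱX₁ᵏ)(mc, e₁, 0)`. [folklore] -/
theorem φx_V (j m i k : ℕ) :
    φx L (V j m i k) =
      eval ![(m : ℂ) * c L, e₁ L, 0] (((Dℂ L).toLinearMap ^ j) (X 0 ^ i * X 1 ^ k)) := by
  unfold V
  rw [φx_aeval_sval, ψx_D₀_pow]
  congr 2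
  simp [map_mul, map_pow]

/-- **Value formula.** `F_p^{(j)}(s_m) = ∑ p (i,k) · φx (V j m i k)`: the derivatives of the
auxiliary function at the points `s_m` are the specialisations at `(κ, g₂/2, c, e₁)` of fixed
integer polynomials. [cite: Chudnovsky1984, Ch. 7 §2 p. 306] -/
theorem iteratedDeriv_F_s {D : ℕ} (p : Fin (D + 1) × Fin (D + 1) → ℂ) (j m : ℕ) :
    iteratedDeriv j (F L D p) (s L m) = ∑ l, p l * φx L (V j m l.1 l.2) := by
  rw [iteratedDeriv_F_s_eq_sum]
  simp_rw [φx_V]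



end DifferentialAlgebra

end Literature.NumberTheory.Transcendental.Chudnovsky

end
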